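import Mathlib
import Literature.Algebra.Polynomial.GramMatrixMethod
import Literature.LinearAlgebra.Matrix.FactorWidthTwo
import Literature.Algebra.Polynomial.PolyaPositivstellensatz
import HarnessLib

/-!
# DSOS and SDSOS polynomials (Ahmadi–Majumdar 2019, §3): the cones `DSOS ⊆ SDSOS ⊆ SOS`, their
# dd / sdd Gram-matrix characterisations, the `r-DSOS`/`r-SDSOS` hierarchy, Pólya-type completeness
# for even positive definite forms, and the separating functional that makes evenness necessary

Topic `Literature/Algebra/Polynomial`, namespace `Literature.Algebra.Polynomial.DsosSdsos`; real
multivariate polynomials `MvPolynomial σ ℝ`.  Builds on `GramMatrixMethod.lean` (`gramPoly Q z = zᵀ Q z`,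
`monomialVec`, `monomialsLE`, the degree bound for sums of squares), on
`Literature.LinearAlgebra.Matrix.FactorWidthTwo` (the matrix cones `DD_n ⊆ SDD_n = FW(2) ⊆ PSD_n`:
`IsDiagDominant`, `IsScaledDiagDominant`, `HasFactorWidthTwo`, [BomanEtAl2005] and
[AhmadiMajumdar2019, §3.1 Definition 3, Lemmas 1–2, Theorem 4]) and on `PolyaPositivstellensatz.lean`
(`Literature.Algebra.Polynomial.polya`, [Polya1928]).

Source, read page by page (`lit read arxiv:1706.02586`, pp. 8–12 of the held text, whose environments
are numbered per kind — the numbering used below and in the `[cite: …]` tags):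

* [AhmadiMajumdar2019] A. A. Ahmadi, A. Majumdar, *DSOS and SDSOS optimization: more tractable
  alternatives to sum of squares and semidefinite optimization*, SIAM J. Appl. Algebra Geom. 3 (2019)
  193–230 (arXiv:1706.02586).
  - §3.1 Definition 1: "A polynomial `p` is diagonally-dominant-sum-of-squares (dsos) if it can be
    written as `p = Σ_i α_i m_i² + Σ_{i,j} β⁺_ij (m_i + m_j)² + Σ_{i,j} β⁻_ij (m_i − m_j)²` for some
    monomials `m_i, m_j` and some nonnegative scalars `α_i, β⁺_ij, β⁻_ij`" (`IsDsos`); Definition 2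
    (sdsos: `Σ_i α_i m_i² + Σ_{i,j} (β̂⁺_ij m_i + β̃⁺_ij m_j)² + Σ_{i,j} (β̂⁻_ij m_i − β̃⁻_ij m_j)²`,
    `α_i ≥ 0`) (`IsSdsos`); the remarks "if `p` has degree `2d`, the monomials … never need to have
    degree higher than `d`" (the `_monomialsLE` statements) and "sum of binomial squares" (normal
    forms `IsDsos.of_terms` / `IsDsos.exists_terms`, `IsSdsos.of_binomials` / `IsSdsos.exists_binomials`);
    `DSOS ⊆ SDSOS ⊆ SOS ⊆ PSD` (`IsDsos.isSdsos`, `IsSdsos.isSumSq`, `IsSdsos.eval_nonneg`) and the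
    evident cone operations (`add`, `sum`, `smul`, `mul_monomial_sq`).
  - Theorem 2: "A polynomial `p` of degree `2d` is dsos if and only if it admits a representation as
    `p(x) = zᵀ(x) Q z(x)`, where `z(x)` is the standard monomial vector of degree `≤ d` and `Q` is a dd
    matrix" (`isDsos_iff_exists_isDiagDominant_monomialsLE`; with a free finite monomial family
    `isDsos_iff_exists_isDiagDominant`).  Direction ⇒ as printed — `Q = Σ_k` of the dd dyads of the
    individual terms (`IsDsos.exists_isDiagDominant`); direction ⇐ through the Barker–Carlson identity
    written out for polynomials, `zᵀQz = Σ_i (Q_ii − Σ_{j≠i} |Q_ij|) z_i² + Σ_{i≠j} |Q_ij|/2 · (z_i + sgn(Q_ij) z_j)²`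
    (`gramPoly_eq_sum_diagDominant`, `IsDsos.of_isDiagDominant`).
  - Theorem 3: "… sdsos if and only if … `Q` is a sdd matrix", combined with Theorem 4 (sdd ⇔ factor
    width at most 2, in `FactorWidthTwo.lean`) (`isSdsos_iff_exists_isScaledDiagDominant_monomialsLE`,
    `isSdsos_iff_exists_isScaledDiagDominant`, `isSdsos_iff_exists_hasFactorWidthTwo`; directions
    `IsSdsos.exists_hasFactorWidthTwo(_monomialsLE)`, `IsSdsos.of_hasFactorWidthTwo`,
    `IsSdsos.of_isScaledDiagDominant`).
  - §3.2 Definition 4: "`p` is r-dsos (resp. r-sdsos) if `p(x)·(Σ_i x_i²)^r` is dsos (resp. sdsos)"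
    (`IsRDsos`, `IsRSdsos`); "for `r = 0` we recover our dsos/sdsos definitions" (`isRDsos_zero_iff`);
    display (3.3) `rDSOS_{n,2d} ⊆ rSDSOS_{n,2d} ⊆ PSD_{n,2d}` "because the multiplier is nonnegative"
    (`IsRDsos.isRSdsos`, `IsRSdsos.eval_nonneg` — over at least one variable, see its docstring);
    nestedness in `r` (`IsRDsos.succ`, `IsRDsos.mono`).
  - Theorem 7: "Let `p` be an even positive definite form. Then, there exists an integer `r` for which
    `p` is r-dsos (and hence r-sdsos)" (`exists_isRDsos_of_even_posDef`, `exists_isRSdsos_of_even_posDef`),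
    with the printed proof: `p(x) = q(x²)`, `q` positive on the simplex, Pólya's theorem
    (`Literature.Algebra.Polynomial.polya`) gives `(Σ y_i)^r q(y)` positive coefficients, and a form in
    the squared variables with nonnegative coefficients is dsos (`isDsos_expand_two_of_coeff_nonneg`).
    The same proof with the Powers–Reznick bound [PowersReznick2001, Thm 1]
    (`Literature.Algebra.Polynomial.polya_powersReznick`) as the Pólya step gives an EFFECTIVE `r`
    (not printed in the source): `p = q(x²)`, `|q_α| ≤ L·D!/α!`, `q ≥ λ` on `Δ` (⟺ `p ≥ λ` on the unit
    sphere, `le_eval_of_le_eval_expand_two_sphere`), `λ(r + D) > L·C(D,2)` ⇒ `p` is r-dsos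
    (`isRDsos_expand_two_of_abs_coeff_le`, `isRDsos_expand_two_of_le_eval_sphere`).
  - Proposition 1: "For any `0 < a < 1`, the quadratic form `p(x₁,x₂,x₃) = (x₁+x₂+x₃)² + a(x₁²+x₂²+x₃²)`
    is positive definite but not r-sdsos for any `r`" (`amCounterexample_posDef`,
    `not_isRSdsos_amCounterexample`, `not_isRDsos_amCounterexample`), through its proof: "a general
    separating hyperplane for the cone of sdsos forms in any degree and dimension" — the functional
    `f ↦ ⟨coeff f, v_f⟩`, `v_f = +1` on even monomials and `−1` otherwise, is nonnegative on sdsos forms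
    (`evenSignForm`, `IsSdsos.evenSignForm_nonneg`) and negative on `p·(Σ x_i²)^r`.  The latter value is
    computed here through the cube identity `2^n ⟨coeff f, v_f⟩ = 2 Σ_{ε ∈ {±1}^n} f(ε) − 2^n f(1,…,1)`
    (`two_pow_mul_evenSignForm`) rather than the source's evaluation of a related form at the all ones
    vector; the `n`-variable statement obtained is `not_isRSdsos_amForm` (`a < n − 2`).
  - Examples 1 and 2: the LP decompositions printed there, showing that the Motzkin form is 2-dsos
    (`M ∈ 2DSOS_{3,6}`) and that `x₁⁴x₂² + x₂⁴x₃² + x₃⁴x₁² − 3x₁²x₂²x₃²` is 1-dsos, hence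
    `1DSOS_{3,6} ⊄ SOS_{3,6}`; verified as polynomial identities and packaged as certificates
    (`two_mul_motzkin_mul_eq`, `isRDsos_two_motzkin`, `two_mul_example2_mul_eq`, `isRDsos_one_example2`,
    `motzkin_nonneg`, `example2_nonneg`).  That these two forms are not sums of squares is not
    re-proved here.

Conventions.  Everything is over `ℝ` (the matrix cones of `FactorWidthTwo.lean` are real).  "dd" always
means *symmetric* dd: Definition 3 of the source defines dd for symmetric matrices, and for a
non-symmetric `Q` with dominant rows the symmetrisation need not be dd, so the Gram statements carry
`Q.IsSymm ∧ IsDiagDominant Q`.  Monomial families are indexed by arbitrary `Fintype`s, repetitions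
allowed; the `Fin k` in Definitions 1–2 only keeps `IsDsos`/`IsSdsos` plain `Prop`s.

Not here: Theorems 5, 6 and 8 (LP / SOCP representability of `DSOS_{n,2d}`, `SDSOS_{n,2d}`, `rDSOS`,
and program sizes — their matrix content is Lemma 2 / Theorem 4 in `FactorWidthTwo.lean`; complexity
statements are not formalised); Theorem (thm:p.dsos.Polya) (general positive definite forms after the
change of basis); §4 (factor width `k`, column generation, iterative methods) and the numerical sections.
Nearest in-tree statements (searched before filing): `Literature.Computation.Certificates.PSD.IsDiagDominant`
/ `IsGramCertDD` (checker-side dd Gram certificates over `ℚ` for concrete matrices — the numeric layer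
this file gives its polynomial meaning), `FactorWidthTwo.lean` (matrix cones only), `GramMatrixMethod.lean`
(sos ⇔ psd Gram matrix); no in-tree declaration defines dsos / sdsos / r-dsos polynomials.
-/

noncomputable section

open MvPolynomial Matrix Finset

open scoped BigOperators

namespace Literature.Algebra.Polynomial.DsosSdsos

open Literature.Algebra.Polynomial.GramMatrixMethod (gramPoly monomialVec monomialsLE
  gramPoly_sum_smul_vecMulVec eq_sum_coeff_mul_monomialVec two_mul_totalDegree_le_of_sum_mul_self_eq
  support_subset_monomialsLE)
open Literature.LinearAlgebra.Matrix (IsDiagDominant IsScaledDiagDominant HasFactorWidthTwo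
  hasFactorWidthTwo_iff_isScaledDiagDominant)

variable {σ : Type*}

/-! ### Definitions 1 and 2: dsos and sdsos polynomials -/

/-- **Definition 1 (dsos).** `p` is *diagonally-dominant-sum-of-squares* if
`p = Σ_i α_i m_i² + Σ_{i,j} β⁺_ij (m_i + m_j)² + Σ_{i,j} β⁻_ij (m_i − m_j)²` for some monomials `m_i`
(here `m_i = X^{m i}` for a finite family of exponents `m : Fin k → σ →₀ ℕ`, repetitions allowed) and
some NONNEGATIVE scalars `α_i, β⁺_ij, β⁻_ij`. [cite: AhmadiMajumdar2019, §3.1 Definition 1 (dsos)] -/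
def IsDsos (p : MvPolynomial σ ℝ) : Prop :=
  ∃ (k : ℕ) (m : Fin k → σ →₀ ℕ) (α : Fin k → ℝ) (βp βm : Fin k → Fin k → ℝ),
    (∀ i, 0 ≤ α i) ∧ (∀ i j, 0 ≤ βp i j) ∧ (∀ i j, 0 ≤ βm i j) ∧
    p = ∑ i, C (α i) * monomial (m i) 1 ^ 2 +
        ∑ i, ∑ j, C (βp i j) * (monomial (m i) 1 + monomial (m j) 1) ^ 2 +
        ∑ i, ∑ j, C (βm i j) * (monomial (m i) 1 - monomial (m j) 1) ^ 2

/-- **Definition 2 (sdsos).** `p` is *scaled-diagonally-dominant-sum-of-squares* if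
`p = Σ_i α_i m_i² + Σ_{i,j} (β̂⁺_ij m_i + β̃⁺_ij m_j)² + Σ_{i,j} (β̂⁻_ij m_i − β̃⁻_ij m_j)²` for some
monomials `m_i` and scalars `α_i ≥ 0`, `β̂^±_ij, β̃^±_ij ∈ ℝ`.
[cite: AhmadiMajumdar2019, §3.1 Definition 2 (sdsos)] -/
def IsSdsos (p : MvPolynomial σ ℝ) : Prop :=
  ∃ (k : ℕ) (m : Fin k → σ →₀ ℕ) (α : Fin k → ℝ) (bh bt ch ct : Fin k → Fin k → ℝ),
    (∀ i, 0 ≤ α i) ∧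
    p = ∑ i, C (α i) * monomial (m i) 1 ^ 2 +
        ∑ i, ∑ j, (C (bh i j) * monomial (m i) 1 + C (bt i j) * monomial (m j) 1) ^ 2 +
        ∑ i, ∑ j, (C (ch i j) * monomial (m i) 1 - C (ct i j) * monomial (m j) 1) ^ 2

/-- Re-indexing a finite sum along `Fintype.equivFin`. [folklore] -/
@[folklore] private theorem sum_equivFin_symm {ι M : Type*} [Fintype ι] [AddCommMonoid M] (f : ι → M) :
    ∑ i : Fin (Fintype.card ι), f ((Fintype.equivFin ι).symm i) = ∑ i, f i :=
  (Fintype.equivFin ι).symm.sum_comp f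

/-- Re-indexing a finite double sum along `Fintype.equivFin`. [folklore] -/
@[folklore] private theorem sum_sum_equivFin_symm {ι M : Type*} [Fintype ι] [AddCommMonoid M] (f : ι → ι → M) :
    ∑ i : Fin (Fintype.card ι), ∑ j : Fin (Fintype.card ι),
      f ((Fintype.equivFin ι).symm i) ((Fintype.equivFin ι).symm j) = ∑ i, ∑ j, f i j := by
  rw [← (Fintype.equivFin ι).symm.sum_comp fun i => ∑ j, f i j]
  exact Finset.sum_congr rfl fun i _ => (Fintype.equivFin ι).symm.sum_comp (f _)

/-- Definition 1 with an arbitrary finite index type for the monomials (the definition fixes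
`Fin k` only to keep `IsDsos` a plain `Prop`). [cite: AhmadiMajumdar2019, §3.1 Definition 1 (dsos)] -/
theorem IsDsos.of_sum {ι : Type*} [Fintype ι] {p : MvPolynomial σ ℝ} (m : ι → σ →₀ ℕ) (α : ι → ℝ)
    (βp βm : ι → ι → ℝ) (hα : ∀ i, 0 ≤ α i) (hβp : ∀ i j, 0 ≤ βp i j) (hβm : ∀ i j, 0 ≤ βm i j)
    (hp : p = ∑ i, C (α i) * monomial (m i) 1 ^ 2 +
        ∑ i, ∑ j, C (βp i j) * (monomial (m i) 1 + monomial (m j) 1) ^ 2 +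
        ∑ i, ∑ j, C (βm i j) * (monomial (m i) 1 - monomial (m j) 1) ^ 2) : IsDsos p := by
  refine ⟨Fintype.card ι, fun i => m ((Fintype.equivFin ι).symm i),
    fun i => α ((Fintype.equivFin ι).symm i),
    fun i j => βp ((Fintype.equivFin ι).symm i) ((Fintype.equivFin ι).symm j),
    fun i j => βm ((Fintype.equivFin ι).symm i) ((Fintype.equivFin ι).symm j),
    fun _ => hα _, fun _ _ => hβp _ _, fun _ _ => hβm _ _, ?_⟩
  rw [hp, sum_equivFin_symm (fun i => C (α i) * monomial (m i) (1 : ℝ) ^ 2),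
    sum_sum_equivFin_symm (fun i j => C (βp i j) * (monomial (m i) (1 : ℝ) + monomial (m j) 1) ^ 2),
    sum_sum_equivFin_symm (fun i j => C (βm i j) * (monomial (m i) (1 : ℝ) - monomial (m j) 1) ^ 2)]

/-- Definition 2 with an arbitrary finite index type for the monomials.
[cite: AhmadiMajumdar2019, §3.1 Definition 2 (sdsos)] -/
theorem IsSdsos.of_sum {ι : Type*} [Fintype ι] {p : MvPolynomial σ ℝ} (m : ι → σ →₀ ℕ) (α : ι → ℝ)
    (bh bt ch ct : ι → ι → ℝ) (hα : ∀ i, 0 ≤ α i)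
    (hp : p = ∑ i, C (α i) * monomial (m i) 1 ^ 2 +
        ∑ i, ∑ j, (C (bh i j) * monomial (m i) 1 + C (bt i j) * monomial (m j) 1) ^ 2 +
        ∑ i, ∑ j, (C (ch i j) * monomial (m i) 1 - C (ct i j) * monomial (m j) 1) ^ 2) :
    IsSdsos p := by
  refine ⟨Fintype.card ι, fun i => m ((Fintype.equivFin ι).symm i),
    fun i => α ((Fintype.equivFin ι).symm i),
    fun i j => bh ((Fintype.equivFin ι).symm i) ((Fintype.equivFin ι).symm j),
    fun i j => bt ((Fintype.equivFin ι).symm i) ((Fintype.equivFin ι).symm j),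
    fun i j => ch ((Fintype.equivFin ι).symm i) ((Fintype.equivFin ι).symm j),
    fun i j => ct ((Fintype.equivFin ι).symm i) ((Fintype.equivFin ι).symm j),
    fun _ => hα _, ?_⟩
  rw [hp, sum_equivFin_symm (fun i => C (α i) * monomial (m i) (1 : ℝ) ^ 2),
    sum_sum_equivFin_symm (fun i j =>
      (C (bh i j) * monomial (m i) (1 : ℝ) + C (bt i j) * monomial (m j) 1) ^ 2),
    sum_sum_equivFin_symm (fun i j =>
      (C (ch i j) * monomial (m i) (1 : ℝ) - C (ct i j) * monomial (m j) 1) ^ 2)]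

/-! ### Normal forms: weighted `(m ± m')²` terms and binomial squares

Every term of (eq:dsos) is `c · (X^γ + s X^δ)²` with `c ≥ 0` and `s ∈ {0, 1, −1}`; every term of
(eq:sdsos) is a *binomial square* `(a X^γ + b X^δ)²` ("sum of binomial squares", the terminology of
Robinson, Reznick and Choi–Lam–Reznick recalled in [AhmadiMajumdar2019, §3.1]). -/

/-- A finite sum of terms `c_t (X^{γ_t} + s_t X^{δ_t})²` with `c_t ≥ 0`, `s_t ∈ {0, 1, −1}` is dsos
(each term is one summand of (eq:dsos)). [cite: AhmadiMajumdar2019, §3.1 Definition 1 (dsos)] -/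
theorem IsDsos.of_terms {ι : Type*} [Fintype ι] {p : MvPolynomial σ ℝ} (γ δ : ι → σ →₀ ℕ)
    (c s : ι → ℝ) (hc : ∀ t, 0 ≤ c t) (hs : ∀ t, s t = 0 ∨ s t = 1 ∨ s t = -1)
    (hp : p = ∑ t, C (c t) * (monomial (γ t) 1 + C (s t) * monomial (δ t) 1) ^ 2) : IsDsos p := by
  classical
  refine IsDsos.of_sum (ι := ι ⊕ ι) (Sum.elim γ δ)
    (Sum.elim (fun t => if s t = 0 then c t else 0) (fun _ => 0))
    (Sum.elim (fun t => Sum.elim (fun _ => 0) (fun t' => if t' = t then (if s t = 1 then c t else 0) else 0))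
      (fun _ _ => 0))
    (Sum.elim (fun t => Sum.elim (fun _ => 0) (fun t' => if t' = t then (if s t = -1 then c t else 0) else 0))
      (fun _ _ => 0))
    ?_ ?_ ?_ ?_
  · rintro (t | t)
    exacts [ite_nonneg (hc t) le_rfl, le_rfl]
  · rintro (t | t) (t' | t')
    exacts [le_rfl, ite_nonneg (ite_nonneg (hc t) le_rfl) le_rfl, le_rfl, le_rfl]
  · rintro (t | t) (t' | t')
    exacts [le_rfl, ite_nonneg (ite_nonneg (hc t) le_rfl) le_rfl, le_rfl, le_rfl]
  rw [hp]
  simp only [Fintype.sum_sum_type, Sum.elim_inl, Sum.elim_inr, map_zero, zero_mul,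
    Finset.sum_const_zero, add_zero, zero_add]
  simp only [apply_ite C, map_zero, ite_mul, zero_mul, Finset.sum_ite_eq', Finset.mem_univ,
    if_true, ← Finset.sum_add_distrib]
  refine Finset.sum_congr rfl fun t _ => ?_
  rcases hs t with h | h | h
  · simp [h]
  · simp only [h, one_ne_zero, if_false, if_true, map_one, one_mul, zero_add, add_zero,
      show (1 : ℝ) ≠ -1 by norm_num]
  · simp only [h, neg_eq_zero, one_ne_zero, if_false, if_true, map_neg, map_one, neg_one_mul,
      zero_add, show (-1 : ℝ) ≠ 1 by norm_num, sub_eq_add_neg]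

/-- Conversely a dsos polynomial is a finite sum of terms `c_t (X^{γ_t} + s_t X^{δ_t})²`, `c_t ≥ 0`,
`s_t ∈ {0, 1, −1}` (the three sums of (eq:dsos) listed one term at a time).
[cite: AhmadiMajumdar2019, §3.1 Definition 1 (dsos)] -/
theorem IsDsos.exists_terms {p : MvPolynomial σ ℝ} (hp : IsDsos p) :
    ∃ (k : ℕ) (γ δ : Fin k → σ →₀ ℕ) (c s : Fin k → ℝ), (∀ t, 0 ≤ c t) ∧
      (∀ t, s t = 0 ∨ s t = 1 ∨ s t = -1) ∧
      p = ∑ t, C (c t) * (monomial (γ t) 1 + C (s t) * monomial (δ t) 1) ^ 2 := by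
  obtain ⟨k, m, α, βp, βm, hα, hβp, hβm, rfl⟩ := hp
  -- index the three sums by `Fin k ⊕ (Fin k × Fin k ⊕ Fin k × Fin k)`
  let T := Fin k ⊕ (Fin k × Fin k ⊕ Fin k × Fin k)
  let γ : T → σ →₀ ℕ := Sum.elim m (Sum.elim (fun ij => m ij.1) (fun ij => m ij.1))
  let δ : T → σ →₀ ℕ := Sum.elim m (Sum.elim (fun ij => m ij.2) (fun ij => m ij.2))
  let c : T → ℝ := Sum.elim α (Sum.elim (fun ij => βp ij.1 ij.2) (fun ij => βm ij.1 ij.2))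
  let s : T → ℝ := Sum.elim (fun _ => 0) (Sum.elim (fun _ => 1) (fun _ => -1))
  have hsum : ∑ i, C (α i) * monomial (m i) (1 : ℝ) ^ 2 +
      ∑ i, ∑ j, C (βp i j) * (monomial (m i) (1 : ℝ) + monomial (m j) 1) ^ 2 +
      ∑ i, ∑ j, C (βm i j) * (monomial (m i) (1 : ℝ) - monomial (m j) 1) ^ 2 =
      ∑ t, C (c t) * (monomial (γ t) 1 + C (s t) * monomial (δ t) 1) ^ 2 := by
    simp only [T, γ, δ, c, s, Fintype.sum_sum_type, Fintype.sum_prod_type, Sum.elim_inl,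
      Sum.elim_inr, map_zero, zero_mul, add_zero, map_one, one_mul, map_neg, neg_one_mul,
      sub_eq_add_neg, add_assoc]
  have hc : ∀ t, 0 ≤ c t := by
    rintro (i | ij | ij)
    exacts [hα i, hβp _ _, hβm _ _]
  have hs : ∀ t, s t = 0 ∨ s t = 1 ∨ s t = -1 := by
    rintro (i | ij | ij)
    exacts [Or.inl rfl, Or.inr (Or.inl rfl), Or.inr (Or.inr rfl)]
  exact ⟨Fintype.card T, fun t => γ ((Fintype.equivFin T).symm t),
    fun t => δ ((Fintype.equivFin T).symm t), fun t => c ((Fintype.equivFin T).symm t),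
    fun t => s ((Fintype.equivFin T).symm t), fun t => hc _, fun t => hs _, by
      rw [hsum, sum_equivFin_symm (fun t => C (c t) * (monomial (γ t) (1 : ℝ) +
        C (s t) * monomial (δ t) 1) ^ 2)]⟩

/-- A finite sum of binomial squares `(a_t X^{γ_t} + b_t X^{δ_t})²` is sdsos.
[cite: AhmadiMajumdar2019, §3.1 Definition 2 (sdsos; "sum of binomial squares")] -/
theorem IsSdsos.of_binomials {ι : Type*} [Fintype ι] {p : MvPolynomial σ ℝ} (γ δ : ι → σ →₀ ℕ)
    (a b : ι → ℝ) (hp : p = ∑ t, (C (a t) * monomial (γ t) 1 + C (b t) * monomial (δ t) 1) ^ 2) :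
    IsSdsos p := by
  classical
  refine IsSdsos.of_sum (ι := ι ⊕ ι) (Sum.elim γ δ) (fun _ => 0)
    (Sum.elim (fun t => Sum.elim (fun _ => 0) (fun t' => if t' = t then a t else 0)) (fun _ _ => 0))
    (Sum.elim (fun t => Sum.elim (fun _ => 0) (fun t' => if t' = t then b t else 0)) (fun _ _ => 0))
    (fun _ _ => 0) (fun _ _ => 0) (fun _ => le_rfl) ?_
  rw [hp]
  simp only [Fintype.sum_sum_type, Sum.elim_inl, Sum.elim_inr, map_zero, zero_mul,
    Finset.sum_const_zero, add_zero, zero_add, sub_zero, ne_eq, OfNat.ofNat_ne_zero,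
    not_false_eq_true, zero_pow]
  refine Finset.sum_congr rfl fun t _ => ?_
  rw [Finset.sum_eq_single t (fun t' _ ht' => by simp [ht']) (fun h => (h (Finset.mem_univ t)).elim)]
  simp

/-- Conversely an sdsos polynomial is a finite sum of binomial squares `(a_t X^{γ_t} + b_t X^{δ_t})²`
(`α_i m_i² = (√α_i m_i)²`). [cite: AhmadiMajumdar2019, §3.1 Definition 2 (sdsos; "sum of binomial squares")] -/
theorem IsSdsos.exists_binomials {p : MvPolynomial σ ℝ} (hp : IsSdsos p) :
    ∃ (k : ℕ) (γ δ : Fin k → σ →₀ ℕ) (a b : Fin k → ℝ),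
      p = ∑ t, (C (a t) * monomial (γ t) 1 + C (b t) * monomial (δ t) 1) ^ 2 := by
  obtain ⟨k, m, α, bh, bt, ch, ct, hα, rfl⟩ := hp
  let T := Fin k ⊕ (Fin k × Fin k ⊕ Fin k × Fin k)
  let γ : T → σ →₀ ℕ := Sum.elim m (Sum.elim (fun ij => m ij.1) (fun ij => m ij.1))
  let δ : T → σ →₀ ℕ := Sum.elim m (Sum.elim (fun ij => m ij.2) (fun ij => m ij.2))
  let a : T → ℝ := Sum.elim (fun i => √(α i)) (Sum.elim (fun ij => bh ij.1 ij.2) (fun ij => ch ij.1 ij.2))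
  let b : T → ℝ := Sum.elim (fun _ => 0) (Sum.elim (fun ij => bt ij.1 ij.2) (fun ij => -ct ij.1 ij.2))
  have hsq : ∀ i, C (α i) * monomial (m i) (1 : ℝ) ^ 2 =
      (C (√(α i)) * monomial (m i) 1 + C 0 * monomial (m i) 1) ^ 2 := fun i => by
    rw [map_zero, zero_mul, add_zero, mul_pow, ← C_pow, Real.sq_sqrt (hα i)]
  have hsum : ∑ i, C (α i) * monomial (m i) (1 : ℝ) ^ 2 +
      ∑ i, ∑ j, (C (bh i j) * monomial (m i) (1 : ℝ) + C (bt i j) * monomial (m j) 1) ^ 2 +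
      ∑ i, ∑ j, (C (ch i j) * monomial (m i) (1 : ℝ) - C (ct i j) * monomial (m j) 1) ^ 2 =
      ∑ t, (C (a t) * monomial (γ t) 1 + C (b t) * monomial (δ t) 1) ^ 2 := by
    simp only [T, γ, δ, a, b, Fintype.sum_sum_type, Fintype.sum_prod_type, Sum.elim_inl,
      Sum.elim_inr, map_neg, neg_mul, sub_eq_add_neg, add_assoc, hsq]
  exact ⟨Fintype.card T, fun t => γ ((Fintype.equivFin T).symm t),
    fun t => δ ((Fintype.equivFin T).symm t), fun t => a ((Fintype.equivFin T).symm t),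
    fun t => b ((Fintype.equivFin T).symm t), by
      rw [hsum, sum_equivFin_symm (fun t => (C (a t) * monomial (γ t) (1 : ℝ) +
        C (b t) * monomial (δ t) 1) ^ 2)]⟩

/-! ### `DSOS ⊆ SDSOS ⊆ SOS ⊆ PSD` and the cone operations -/

/-- `DSOS_{n,2d} ⊆ SDSOS_{n,2d}`: `c (X^γ + s X^δ)² = (√c X^γ + √c s X^δ)²`.
[cite: AhmadiMajumdar2019, §3.1 (DSOS ⊆ SDSOS ⊆ SOS ⊆ PSD)] -/
theorem IsDsos.isSdsos {p : MvPolynomial σ ℝ} (hp : IsDsos p) : IsSdsos p := by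
  obtain ⟨k, γ, δ, c, s, hc, -, rfl⟩ := hp.exists_terms
  refine IsSdsos.of_binomials γ δ (fun t => √(c t)) (fun t => √(c t) * s t)
    (Finset.sum_congr rfl fun t _ => ?_)
  rw [map_mul, mul_assoc, ← mul_add, mul_pow, ← C_pow, Real.sq_sqrt (hc t)]

/-- `SDSOS_{n,2d} ⊆ SOS_{n,2d}`: an sdsos polynomial is a sum of squares of polynomials.
[cite: AhmadiMajumdar2019, §3.1 (DSOS ⊆ SDSOS ⊆ SOS ⊆ PSD)] -/
theorem IsSdsos.isSumSq {p : MvPolynomial σ ℝ} (hp : IsSdsos p) : IsSumSq p := by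
  obtain ⟨k, γ, δ, a, b, rfl⟩ := hp.exists_binomials
  simpa only [sq] using IsSumSq.sum_mul_self Finset.univ
    (fun t => C (a t) * monomial (γ t) (1 : ℝ) + C (b t) * monomial (δ t) 1)

/-- `DSOS_{n,2d} ⊆ SOS_{n,2d}`. [cite: AhmadiMajumdar2019, §3.1 (DSOS ⊆ SDSOS ⊆ SOS ⊆ PSD)] -/
theorem IsDsos.isSumSq {p : MvPolynomial σ ℝ} (hp : IsDsos p) : IsSumSq p :=
  hp.isSdsos.isSumSq

/-- `SDSOS_{n,2d} ⊆ PSD_{n,2d}`: an sdsos polynomial is nonnegative on `ℝⁿ`.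
[cite: AhmadiMajumdar2019, §3.1 (DSOS ⊆ SDSOS ⊆ SOS ⊆ PSD)] -/
theorem IsSdsos.eval_nonneg {p : MvPolynomial σ ℝ} (hp : IsSdsos p) (x : σ → ℝ) : 0 ≤ eval x p := by
  obtain ⟨k, γ, δ, a, b, rfl⟩ := hp.exists_binomials
  rw [map_sum]
  exact Finset.sum_nonneg fun t _ => by rw [map_pow]; exact sq_nonneg _

/-- `DSOS_{n,2d} ⊆ PSD_{n,2d}`. [cite: AhmadiMajumdar2019, §3.1 (DSOS ⊆ SDSOS ⊆ SOS ⊆ PSD)] -/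
theorem IsDsos.eval_nonneg {p : MvPolynomial σ ℝ} (hp : IsDsos p) (x : σ → ℝ) : 0 ≤ eval x p :=
  hp.isSdsos.eval_nonneg x

/-- `0` is dsos (the empty decomposition). [cite: AhmadiMajumdar2019, §3.1 (the cone DSOS_{n,2d})] -/
theorem isDsos_zero : IsDsos (0 : MvPolynomial σ ℝ) :=
  IsDsos.of_terms (ι := Fin 0) Fin.elim0 Fin.elim0 Fin.elim0 Fin.elim0 (fun t => t.elim0)
    (fun t => t.elim0) (by simp)

/-- `0` is sdsos. [cite: AhmadiMajumdar2019, §3.1 (the cone SDSOS_{n,2d})] -/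
theorem isSdsos_zero : IsSdsos (0 : MvPolynomial σ ℝ) :=
  isDsos_zero.isSdsos

/-- `DSOS_{n,2d}` is closed under addition (concatenate the decompositions).
[cite: AhmadiMajumdar2019, §3.1 (the cone DSOS_{n,2d})] -/
theorem IsDsos.add {p q : MvPolynomial σ ℝ} (hp : IsDsos p) (hq : IsDsos q) : IsDsos (p + q) := by
  obtain ⟨k, γ, δ, c, s, hc, hs, rfl⟩ := hp.exists_terms
  obtain ⟨k', γ', δ', c', s', hc', hs', rfl⟩ := hq.exists_terms
  refine IsDsos.of_terms (ι := Fin k ⊕ Fin k') (Sum.elim γ γ') (Sum.elim δ δ') (Sum.elim c c')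
    (Sum.elim s s') ?_ ?_ ?_
  · rintro (t | t) <;> simp [hc, hc']
  · rintro (t | t)
    · exact hs t
    · exact hs' t
  · simp only [Fintype.sum_sum_type, Sum.elim_inl, Sum.elim_inr]

/-- `SDSOS_{n,2d}` is closed under addition. [cite: AhmadiMajumdar2019, §3.1 (the cone SDSOS_{n,2d})] -/
theorem IsSdsos.add {p q : MvPolynomial σ ℝ} (hp : IsSdsos p) (hq : IsSdsos q) : IsSdsos (p + q) := by
  obtain ⟨k, γ, δ, a, b, rfl⟩ := hp.exists_binomials
  obtain ⟨k', γ', δ', a', b', rfl⟩ := hq.exists_binomials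
  exact IsSdsos.of_binomials (ι := Fin k ⊕ Fin k') (Sum.elim γ γ') (Sum.elim δ δ') (Sum.elim a a')
    (Sum.elim b b') (by simp only [Fintype.sum_sum_type, Sum.elim_inl, Sum.elim_inr])

/-- `DSOS_{n,2d}` is closed under finite sums. [cite: AhmadiMajumdar2019, §3.1 (the cone DSOS_{n,2d})] -/
theorem IsDsos.sum {ι : Type*} {f : ι → MvPolynomial σ ℝ} (s : Finset ι) (h : ∀ i ∈ s, IsDsos (f i)) :
    IsDsos (∑ i ∈ s, f i) := by
  classical
  induction s using Finset.induction_on with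
  | empty => simpa using isDsos_zero
  | insert a s ha ih =>
    rw [Finset.sum_insert ha]
    exact (h a (Finset.mem_insert_self a s)).add (ih fun i hi => h i (Finset.mem_insert_of_mem hi))

/-- `SDSOS_{n,2d}` is closed under finite sums. [cite: AhmadiMajumdar2019, §3.1 (the cone SDSOS_{n,2d})] -/
theorem IsSdsos.sum {ι : Type*} {f : ι → MvPolynomial σ ℝ} (s : Finset ι) (h : ∀ i ∈ s, IsSdsos (f i)) :
    IsSdsos (∑ i ∈ s, f i) := by
  classical
  induction s using Finset.induction_on with
  | empty => simpa using isSdsos_zero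
  | insert a s ha ih =>
    rw [Finset.sum_insert ha]
    exact (h a (Finset.mem_insert_self a s)).add (ih fun i hi => h i (Finset.mem_insert_of_mem hi))

/-- `DSOS_{n,2d}` is closed under multiplication by nonnegative scalars.
[cite: AhmadiMajumdar2019, §3.1 (the cone DSOS_{n,2d})] -/
theorem IsDsos.smul {p : MvPolynomial σ ℝ} (hp : IsDsos p) {a : ℝ} (ha : 0 ≤ a) : IsDsos (C a * p) := by
  obtain ⟨k, γ, δ, c, s, hc, hs, rfl⟩ := hp.exists_terms
  refine IsDsos.of_terms γ δ (fun t => a * c t) s (fun t => mul_nonneg ha (hc t)) hs ?_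
  rw [Finset.mul_sum]
  exact Finset.sum_congr rfl fun t _ => by rw [map_mul, mul_assoc]

/-- `SDSOS_{n,2d}` is closed under multiplication by nonnegative scalars.
[cite: AhmadiMajumdar2019, §3.1 (the cone SDSOS_{n,2d})] -/
theorem IsSdsos.smul {p : MvPolynomial σ ℝ} (hp : IsSdsos p) {a : ℝ} (ha : 0 ≤ a) :
    IsSdsos (C a * p) := by
  obtain ⟨k, γ, δ, u, v, rfl⟩ := hp.exists_binomials
  refine IsSdsos.of_binomials γ δ (fun t => √a * u t) (fun t => √a * v t) ?_
  rw [Finset.mul_sum]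
  refine Finset.sum_congr rfl fun t _ => ?_
  rw [map_mul, map_mul, mul_assoc, mul_assoc, ← mul_add, mul_pow, ← C_pow, Real.sq_sqrt ha]

/-- A dsos polynomial times a squared monomial is dsos (shift every monomial of (eq:dsos)).
[cite: AhmadiMajumdar2019, §3.1 Definition 1 (dsos)] -/
theorem IsDsos.mul_monomial_sq {p : MvPolynomial σ ℝ} (hp : IsDsos p) (β : σ →₀ ℕ) :
    IsDsos (p * monomial β 1 ^ 2) := by
  obtain ⟨k, γ, δ, c, s, hc, hs, rfl⟩ := hp.exists_terms
  refine IsDsos.of_terms (fun t => γ t + β) (fun t => δ t + β) c s hc hs ?_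
  rw [Finset.sum_mul]
  refine Finset.sum_congr rfl fun t _ => ?_
  rw [mul_assoc, ← mul_pow, add_mul, mul_assoc, monomial_mul, monomial_mul, mul_one]

/-- An sdsos polynomial times a squared monomial is sdsos.
[cite: AhmadiMajumdar2019, §3.1 Definition 2 (sdsos)] -/
theorem IsSdsos.mul_monomial_sq {p : MvPolynomial σ ℝ} (hp : IsSdsos p) (β : σ →₀ ℕ) :
    IsSdsos (p * monomial β 1 ^ 2) := by
  obtain ⟨k, γ, δ, a, b, rfl⟩ := hp.exists_binomials
  refine IsSdsos.of_binomials (fun t => γ t + β) (fun t => δ t + β) a b ?_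
  rw [Finset.sum_mul]
  refine Finset.sum_congr rfl fun t _ => ?_
  rw [← mul_pow, add_mul, mul_assoc, mul_assoc, monomial_mul, monomial_mul, mul_one]

/-! ### Gram matrices: Theorem 2 (dsos ⇔ dd Gram matrix) and Theorem 3 (sdsos ⇔ sdd Gram matrix)

`gramPoly Q z = zᵀ Q z` and `monomialVec S` (the vector of the monomials `X^β`, `β ∈ S`) are those of
`Literature.Algebra.Polynomial.GramMatrixMethod`; `IsDiagDominant`, `IsScaledDiagDominant`,
`HasFactorWidthTwo` are the matrix cones `DD_n ⊆ SDD_n` of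
`Literature.LinearAlgebra.Matrix.FactorWidthTwo` ([AhmadiMajumdar2019, Definition 3, Theorem 4]). -/

section Gram

variable {ι : Type*} [Fintype ι] [DecidableEq ι]

/-- A nonnegative combination `Σ_t c_t v_t v_tᵀ` of dyads each of which is diagonally dominant
(`Σ_{b ≠ a} |v_a v_b| ≤ v_a²` in every row `a`) is diagonally dominant — "the sum of dd matrices is
dd", applied to the rank-one dd matrices of Barker and Carlson.
[cite: AhmadiMajumdar2019, §3.1 Lemma 1 and proof of Theorem 2 ("as the sum of dd matrices is dd")] -/
theorem isDiagDominant_sum_smul_vecMulVec {T : Type*} [Fintype T] (c : T → ℝ) (v : T → ι → ℝ)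
    (hc : ∀ t, 0 ≤ c t) (hv : ∀ t a, ∑ b ∈ univ.erase a, |v t a * v t b| ≤ v t a * v t a) :
    IsDiagDominant (∑ t, c t • vecMulVec (v t) (v t)) := by
  intro a
  simp only [Matrix.sum_apply, Matrix.smul_apply, vecMulVec_apply, smul_eq_mul]
  calc ∑ b ∈ univ.erase a, |∑ t, c t * (v t a * v t b)|
      ≤ ∑ b ∈ univ.erase a, ∑ t, c t * |v t a * v t b| := by
        refine Finset.sum_le_sum fun b _ => (Finset.abs_sum_le_sum_abs _ _).trans_eq ?_
        exact Finset.sum_congr rfl fun t _ => by rw [abs_mul, abs_of_nonneg (hc t)]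
    _ = ∑ t, c t * ∑ b ∈ univ.erase a, |v t a * v t b| := by
        rw [Finset.sum_comm]
        exact Finset.sum_congr rfl fun t _ => (Finset.mul_sum _ _ _).symm
    _ ≤ ∑ t, c t * (v t a * v t a) :=
        Finset.sum_le_sum fun t _ => mul_le_mul_of_nonneg_left (hv t a) (hc t)

omit [Fintype ι] [DecidableEq ι] in
/-- A combination of dyads `Σ_t c_t v_t v_tᵀ` is a symmetric matrix.
[cite: AhmadiMajumdar2019, §3.1 Lemma 1 (the rank-one matrices V_i = v vᵀ)] -/
theorem isSymm_sum_smul_vecMulVec {T : Type*} [Fintype T] (c : T → ℝ) (v : T → ι → ℝ) :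
    (∑ t, c t • vecMulVec (v t) (v t)).IsSymm :=
  Matrix.IsSymm.ext fun i j => by
    simp only [Matrix.sum_apply, Matrix.smul_apply, vecMulVec_apply, smul_eq_mul]
    exact Finset.sum_congr rfl fun t _ => by ring

/-- The coefficient vector of the binomial `a X^γ + b X^δ` on a finite set `S` of exponents
(plumbing for the Gram matrices of (eq:dsos)/(eq:sdsos)). -/
@[folklore] private def binVec [DecidableEq σ] (S : Finset (σ →₀ ℕ)) (γ δ : σ →₀ ℕ) (a b : ℝ) :
    S → ℝ :=
  fun β => (if γ = β.1 then a else 0) + if δ = β.1 then b else 0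

/-- `a X^γ + b X^δ = binVec · z_S` when both monomials that occur lie in `S`. [folklore] -/
@[folklore] private theorem eq_sum_binVec [DecidableEq σ] {S : Finset (σ →₀ ℕ)} {γ δ : σ →₀ ℕ} {a b : ℝ}
    (hS : (C a * monomial γ (1 : ℝ) + C b * monomial δ 1).support ⊆ S) :
    C a * monomial γ (1 : ℝ) + C b * monomial δ 1 = ∑ β : S, C (binVec S γ δ a b β) * monomialVec S β := by
  conv_lhs => rw [eq_sum_coeff_mul_monomialVec hS]
  refine Finset.sum_congr rfl fun β _ => ?_
  simp only [binVec, coeff_add, coeff_C_mul, coeff_monomial, mul_ite, mul_one, mul_zero]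

/-- At most one element of the subtype `S` has a given underlying exponent, so an indicator sum over
`S ∖ {a}` is at most its weight. [folklore] -/
@[folklore] private theorem sum_erase_ite_le [DecidableEq σ] (S : Finset (σ →₀ ℕ)) {x : ℝ} (hx : 0 ≤ x)
    (δ : σ →₀ ℕ) (a : S) :
    ∑ b ∈ univ.erase a, (if δ = b.1 then x else 0) ≤ x := by
  calc ∑ b ∈ univ.erase a, (if δ = b.1 then x else 0)
      ≤ ∑ b : S, (if δ = b.1 then x else 0) :=
        Finset.sum_le_sum_of_subset_of_nonneg (Finset.erase_subset _ _)
          fun b _ _ => ite_nonneg hx le_rfl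
    _ = ∑ β ∈ S, (if δ = β then x else 0) := Finset.sum_coe_sort S (fun β => if δ = β then x else 0)
    _ ≤ x := by rw [Finset.sum_ite_eq]; split_ifs <;> simp [hx]

/-- The Barker–Carlson vectors are diagonally dominant dyads: the coefficient vector `w` of
`X^γ + s X^δ` with `s ∈ {0, 1, −1}` has `Σ_{b ≠ a} |w_a w_b| ≤ w_a²` in every row.
[cite: AhmadiMajumdar2019, §3.1 Lemma 1 (vectors with at most 2 nonzero components, each ±1) and proof of Theorem 2 ("all the Q_k … are dd")] -/
private theorem binVec_row_le [DecidableEq σ] (S : Finset (σ →₀ ℕ)) (γ δ : σ →₀ ℕ) {s : ℝ}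
    (hs : s = 0 ∨ s = 1 ∨ s = -1) (a : S) :
    ∑ b ∈ univ.erase a, |binVec S γ δ 1 s a * binVec S γ δ 1 s b| ≤
      binVec S γ δ 1 s a * binVec S γ δ 1 s a := by
  have hs1 : |s| ≤ 1 := by rcases hs with h | h | h <;> simp [h]
  have hs2 : |s| ≤ s * s := by rcases hs with h | h | h <;> simp [h]
  by_cases hγδ : γ = δ
  · subst hγδ
    have h0 : ∀ b ∈ univ.erase a, |binVec S γ γ 1 s a * binVec S γ γ 1 s b| = 0 := by
      intro b hb
      have hba : b ≠ a := (Finset.mem_erase.1 hb).1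
      by_cases hγa : γ = a.1
      · have hγb : ¬ γ = b.1 := fun h => hba (Subtype.ext (h.symm.trans hγa))
        simp [binVec, hγb]
      · simp [binVec, hγa]
    rw [Finset.sum_eq_zero h0]
    exact mul_self_nonneg _
  · by_cases hγa : γ = a.1
    · have hδa : ¬ δ = a.1 := fun h => hγδ (hγa.trans h.symm)
      have hwa : binVec S γ δ 1 s a = 1 := by simp [binVec, hγa, hδa]
      rw [hwa, one_mul]
      calc ∑ b ∈ univ.erase a, |1 * binVec S γ δ 1 s b|
          = ∑ b ∈ univ.erase a, (if δ = b.1 then |s| else 0) := by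
            refine Finset.sum_congr rfl fun b hb => ?_
            have hγb : ¬ γ = b.1 := fun h =>
              (Finset.mem_erase.1 hb).1 (Subtype.ext (h.symm.trans hγa))
            simp only [binVec, hγb, if_false, zero_add, one_mul]
            split_ifs <;> simp
        _ ≤ |s| := sum_erase_ite_le S (abs_nonneg s) δ a
        _ ≤ 1 := hs1
    · by_cases hδa : δ = a.1
      · have hwa : binVec S γ δ 1 s a = s := by simp [binVec, hγa, hδa]
        rw [hwa]
        calc ∑ b ∈ univ.erase a, |s * binVec S γ δ 1 s b|
            = ∑ b ∈ univ.erase a, (if γ = b.1 then |s| else 0) := by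
              refine Finset.sum_congr rfl fun b hb => ?_
              have hδb : ¬ δ = b.1 := fun h =>
                (Finset.mem_erase.1 hb).1 (Subtype.ext (h.symm.trans hδa))
              simp only [binVec, hδb, if_false, add_zero]
              split_ifs <;> simp
          _ ≤ |s| := sum_erase_ite_le S (abs_nonneg s) γ a
          _ ≤ s * s := hs2
      · have hwa : binVec S γ δ 1 s a = 0 := by simp [binVec, hγa, hδa]
        simp [hwa]

/-- **Theorem 2, "dsos ⇒ dd Gram matrix", on any monomial set containing the monomials used.**
For `p = Σ_t c_t (X^{γ_t} + s_t X^{δ_t})²` (`c_t ≥ 0`, `s_t ∈ {0, ±1}`) and a finite set `S` of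
exponents containing every monomial occurring in the terms, `p = z_Sᵀ Q z_S` with
`Q = Σ_t c_t w_t w_tᵀ` symmetric and diagonally dominant (`w_t` = coefficient vector of the term:
"each `Q_k` … corresponds to a single term in the expansion (eq:dsos) … the sum of dd matrices is dd").
[cite: AhmadiMajumdar2019, §3.1 Theorem 2 (proof, reverse direction)] -/
theorem exists_isDiagDominant_of_terms [DecidableEq σ] {T : Type*} [Fintype T]
    (γ δ : T → σ →₀ ℕ) (c s : T → ℝ) (hc : ∀ t, 0 ≤ c t) (hs : ∀ t, s t = 0 ∨ s t = 1 ∨ s t = -1)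
    (S : Finset (σ →₀ ℕ))
    (hS : ∀ t, (monomial (γ t) (1 : ℝ) + C (s t) * monomial (δ t) 1).support ⊆ S) :
    ∃ Q : Matrix S S ℝ, Q.IsSymm ∧ IsDiagDominant Q ∧
      ∑ t, C (c t) * (monomial (γ t) 1 + C (s t) * monomial (δ t) 1) ^ 2 =
        gramPoly Q (monomialVec S) := by
  have hS' : ∀ t, (C 1 * monomial (γ t) (1 : ℝ) + C (s t) * monomial (δ t) 1).support ⊆ S :=
    fun t => by rw [C_1, one_mul]; exact hS t
  refine ⟨∑ t, c t • vecMulVec (binVec S (γ t) (δ t) 1 (s t)) (binVec S (γ t) (δ t) 1 (s t)),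
    isSymm_sum_smul_vecMulVec _ _,
    isDiagDominant_sum_smul_vecMulVec _ _ hc fun t a => binVec_row_le S _ _ (hs t) a, ?_⟩
  rw [gramPoly_sum_smul_vecMulVec]
  refine Finset.sum_congr rfl fun t _ => ?_
  rw [← eq_sum_binVec (hS' t), C_1, one_mul, sq]

/-- **Theorem 2, "dsos ⇒ dd Gram matrix".** A dsos polynomial is `z_Sᵀ Q z_S` for some finite
set `S` of monomials and some symmetric diagonally dominant `Q`.
[cite: AhmadiMajumdar2019, §3.1 Theorem 2 (dsos ⇔ p = zᵀQz with Q dd), ⇒] -/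
theorem IsDsos.exists_isDiagDominant [DecidableEq σ] {p : MvPolynomial σ ℝ} (hp : IsDsos p) :
    ∃ (S : Finset (σ →₀ ℕ)) (Q : Matrix S S ℝ), Q.IsSymm ∧ IsDiagDominant Q ∧
      p = gramPoly Q (monomialVec S) := by
  obtain ⟨k, γ, δ, c, s, hc, hs, rfl⟩ := hp.exists_terms
  exact ⟨_, exists_isDiagDominant_of_terms γ δ c s hc hs
    (Finset.univ.biUnion fun t => (monomial (γ t) (1 : ℝ) + C (s t) * monomial (δ t) 1).support)
    fun t => Finset.subset_biUnion_of_mem (fun t => (monomial (γ t) (1 : ℝ) +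
      C (s t) * monomial (δ t) 1).support) (Finset.mem_univ t)⟩

/-- **The degree remark + Theorem 2 (⇒) with the standard monomial vector.** "If `p` has degree
`2d`, the monomials in (eq:dsos) never need to have degree higher than `d`": after discarding the
terms with zero weight, every term `c_t u_t²` has `2 deg u_t ≤ deg p ≤ 2d` (top-degree parts of a sum
of squares cannot cancel), so `p = z_dᵀ Q z_d` with `z_d` the vector of ALL monomials of degree
`≤ d` and `Q` symmetric dd. [cite: AhmadiMajumdar2019, §3.1 Theorem 2 and the remark after Definition 2 (monomials of degree ≤ d suffice)] -/
theorem IsDsos.exists_isDiagDominant_monomialsLE [Fintype σ] [DecidableEq σ] {p : MvPolynomial σ ℝ}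
    {d : ℕ} (hp : IsDsos p) (hd : p.totalDegree ≤ 2 * d) :
    ∃ Q : Matrix (monomialsLE σ d) (monomialsLE σ d) ℝ, Q.IsSymm ∧ IsDiagDominant Q ∧
      p = gramPoly Q (monomialVec (monomialsLE σ d)) := by
  obtain ⟨k, γ, δ, c, s, hc, hs, rfl⟩ := hp.exists_terms
  -- keep only the terms with nonzero weight
  have hsplit : ∑ t, C (c t) * (monomial (γ t) (1 : ℝ) + C (s t) * monomial (δ t) 1) ^ 2 =
      ∑ t : {t : Fin k // c t ≠ 0},
        C (c t.1) * (monomial (γ t.1) (1 : ℝ) + C (s t.1) * monomial (δ t.1) 1) ^ 2 := by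
    rw [← Finset.sum_filter_of_ne (s := Finset.univ) (p := fun t => c t ≠ 0)
      (fun t _ h hct => h (by rw [hct, map_zero, zero_mul]))]
    exact Finset.sum_subtype _ (fun t => by simp)
      (fun t => C (c t) * (monomial (γ t) (1 : ℝ) + C (s t) * monomial (δ t) 1) ^ 2)
  -- the degree bound for the surviving terms
  have hsq : ∑ t, C (c t) * (monomial (γ t) (1 : ℝ) + C (s t) * monomial (δ t) 1) ^ 2 =
      ∑ t : {t : Fin k // c t ≠ 0},
        (C (√(c t.1)) * (monomial (γ t.1) (1 : ℝ) + C (s t.1) * monomial (δ t.1) 1)) *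
        (C (√(c t.1)) * (monomial (γ t.1) (1 : ℝ) + C (s t.1) * monomial (δ t.1) 1)) := by
    rw [hsplit]
    refine Finset.sum_congr rfl fun t _ => ?_
    rw [mul_mul_mul_comm, ← map_mul, Real.mul_self_sqrt (hc _), sq]
  have hS : ∀ t : {t : Fin k // c t ≠ 0},
      (monomial (γ t.1) (1 : ℝ) + C (s t.1) * monomial (δ t.1) 1).support ⊆ monomialsLE σ d := by
    intro t β hβ
    have h2 := two_mul_totalDegree_le_of_sum_mul_self_eq _ hsq t
    refine support_subset_monomialsLE (u := C (√(c t.1)) *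
      (monomial (γ t.1) (1 : ℝ) + C (s t.1) * monomial (δ t.1) 1)) (by omega) ?_
    rw [mem_support_iff, coeff_C_mul]
    exact mul_ne_zero (Real.sqrt_ne_zero'.2 (lt_of_le_of_ne (hc _) (Ne.symm t.2)))
      (mem_support_iff.1 hβ)
  obtain ⟨Q, h1, h2, h3⟩ := exists_isDiagDominant_of_terms _ _ _ _ (fun t => hc _) (fun t => hs _)
    (monomialsLE σ d) hS
  exact ⟨Q, h1, h2, hsplit.trans h3⟩

/-- The weights of the Barker–Carlson decomposition of a dd matrix (plumbing). -/
@[folklore] private def ddWeight (Q : Matrix ι ι ℝ) (i j : ι) : ℝ := if i = j then 0 else |Q i j| / 2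

/-- The signs of the Barker–Carlson decomposition of a dd matrix (plumbing). -/
@[folklore] private def ddSign (Q : Matrix ι ι ℝ) (i j : ι) : ℝ := if 0 ≤ Q i j then 1 else -1

/-- **Theorem 2, "dd Gram matrix ⇒ dsos" (via Lemma 1 of Barker–Carlson), as an identity.**  For a
symmetric `Q` and any vector of polynomials `z`,
`zᵀ Q z = Σ_i (Q_ii − Σ_{j≠i} |Q_ij|) z_i² + Σ_{i≠j} (|Q_ij|/2) (z_i + sign(Q_ij) z_j)²`;
when `Q` is dd every weight is `≥ 0` ("the vectors with one nonzero entry lead to the first sum in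
(eq:dsos), those with two 1s or two −1s to the second, those with one 1 and one −1 to the third").
[cite: AhmadiMajumdar2019, §3.1 Theorem 2 (proof, first direction) with Lemma 1 (Barker and Carlson)] -/
theorem gramPoly_eq_sum_diagDominant (Q : Matrix ι ι ℝ) (hQ : Q.IsSymm) (z : ι → MvPolynomial σ ℝ) :
    gramPoly Q z = ∑ i, C (Q i i - ∑ j ∈ univ.erase i, |Q i j|) * z i ^ 2 +
      ∑ i, ∑ j, C (if i = j then 0 else |Q i j| / 2) *
        (z i + C (if 0 ≤ Q i j then 1 else -1) * z j) ^ 2 := by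
  show gramPoly Q z = ∑ i, C (Q i i - ∑ j ∈ univ.erase i, |Q i j|) * z i ^ 2 +
      ∑ i, ∑ j, C (ddWeight Q i j) * (z i + C (ddSign Q i j) * z j) ^ 2
  have hss : ∀ i j, ddSign Q i j * ddSign Q i j = 1 := fun i j => by
    unfold ddSign; split_ifs <;> norm_num
  have hAs : ∀ i j, 2 * ddWeight Q i j * ddSign Q i j = if i = j then 0 else Q i j := fun i j => by
    unfold ddWeight ddSign
    by_cases hij : i = j
    · simp [hij]
    · by_cases h0 : 0 ≤ Q i j
      · rw [if_neg hij, if_pos h0, if_neg hij, abs_of_nonneg h0]; ring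
      · rw [if_neg hij, if_neg h0, if_neg hij, abs_of_neg (lt_of_not_ge h0)]; ring
  have hAsymm : ∀ i j, ddWeight Q i j = ddWeight Q j i := fun i j => by
    unfold ddWeight
    rw [hQ.apply i j]
    by_cases hij : i = j
    · rw [if_pos hij, if_pos hij.symm]
    · rw [if_neg hij, if_neg (Ne.symm hij)]
  have hR : ∀ i, ∑ j ∈ univ.erase i, |Q i j| = ∑ j, 2 * ddWeight Q i j := fun i => by
    rw [← Finset.sum_erase univ (a := i) (f := fun j => 2 * ddWeight Q i j) (by simp [ddWeight])]
    refine Finset.sum_congr rfl fun j hj => ?_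
    rw [ddWeight, if_neg (Ne.symm (Finset.mem_erase.1 hj).1)]; ring
  -- pointwise expansion of the mixed terms
  have e1 : ∀ i j, C (ddWeight Q i j) * (z i + C (ddSign Q i j) * z j) ^ 2 =
      C (ddWeight Q i j) * z i ^ 2 + C (if i = j then 0 else Q i j) * (z i * z j) +
        C (ddWeight Q i j) * z j ^ 2 := fun i j => by
    have h1 : C (ddSign Q i j) * C (ddSign Q i j) = (1 : MvPolynomial σ ℝ) := by
      rw [← map_mul, hss, map_one]
    rw [← hAs i j]
    simp only [map_mul, map_ofNat]
    linear_combination (C (ddWeight Q i j) * z j ^ 2) * h1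
  -- the Gram polynomial split into diagonal and off-diagonal parts
  have hgram : gramPoly Q z = ∑ i, C (Q i i) * z i ^ 2 +
      ∑ i, ∑ j, C (if i = j then 0 else Q i j) * (z i * z j) := by
    rw [gramPoly, ← Finset.sum_add_distrib]
    refine Finset.sum_congr rfl fun i _ => ?_
    have : ∀ j, C (if i = j then 0 else Q i j) * (z i * z j) =
        C (Q i j) * (z i * z j) - if i = j then C (Q i j) * (z i * z j) else 0 := fun j => by
      split_ifs <;> simp
    rw [Finset.sum_congr rfl fun j _ => this j, Finset.sum_sub_distrib, Finset.sum_ite_eq,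
      if_pos (Finset.mem_univ i), sq]
    ring
  have hRX : ∑ i, C (∑ j ∈ univ.erase i, |Q i j|) * z i ^ 2 =
      2 * ∑ i, ∑ j, C (ddWeight Q i j) * z i ^ 2 := by
    rw [Finset.mul_sum]
    refine Finset.sum_congr rfl fun i _ => ?_
    rw [hR, map_sum, Finset.sum_mul, Finset.mul_sum]
    refine Finset.sum_congr rfl fun j _ => ?_
    rw [map_mul, map_ofNat]
    ring
  have hX3 : ∑ i, ∑ j, C (ddWeight Q i j) * z j ^ 2 = ∑ i, ∑ j, C (ddWeight Q i j) * z i ^ 2 := by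
    rw [Finset.sum_comm]
    exact Finset.sum_congr rfl fun i _ => Finset.sum_congr rfl fun j _ => by rw [hAsymm]
  have hsplit : ∑ i, C (Q i i - ∑ j ∈ univ.erase i, |Q i j|) * z i ^ 2 =
      ∑ i, C (Q i i) * z i ^ 2 - ∑ i, C (∑ j ∈ univ.erase i, |Q i j|) * z i ^ 2 := by
    simp only [map_sub, sub_mul, Finset.sum_sub_distrib]
  have hexp : ∑ i, ∑ j, C (ddWeight Q i j) * (z i + C (ddSign Q i j) * z j) ^ 2 =
      ∑ i, ∑ j, C (ddWeight Q i j) * z i ^ 2 +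
        ∑ i, ∑ j, C (if i = j then 0 else Q i j) * (z i * z j) +
        ∑ i, ∑ j, C (ddWeight Q i j) * z j ^ 2 := by
    simp only [e1, Finset.sum_add_distrib]
  rw [hgram, hsplit, hexp]
  linear_combination hRX - hX3

/-- **Theorem 2, "dd Gram matrix ⇒ dsos".** If `p = zᵀ Q z` for a vector `z` of monomials
(any finite family, repetitions allowed) and a symmetric diagonally dominant `Q`, then `p` is dsos.
[cite: AhmadiMajumdar2019, §3.1 Theorem 2 (dsos ⇔ p = zᵀQz with Q dd), ⇐] -/
theorem IsDsos.of_isDiagDominant (m : ι → σ →₀ ℕ) {Q : Matrix ι ι ℝ} (hQs : Q.IsSymm)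
    (hQ : IsDiagDominant Q) {p : MvPolynomial σ ℝ} (hp : p = gramPoly Q fun i => monomial (m i) 1) :
    IsDsos p := by
  refine IsDsos.of_terms (ι := ι ⊕ ι × ι) (Sum.elim m fun ij => m ij.1) (Sum.elim m fun ij => m ij.2)
    (Sum.elim (fun i => Q i i - ∑ j ∈ univ.erase i, |Q i j|)
      fun ij => if ij.1 = ij.2 then 0 else |Q ij.1 ij.2| / 2)
    (Sum.elim (fun _ => 0) fun ij => if 0 ≤ Q ij.1 ij.2 then 1 else -1) ?_ ?_ ?_
  · rintro (i | ij)
    · exact sub_nonneg.2 (hQ i)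
    · simp only [Sum.elim_inr]
      split_ifs
      exacts [le_rfl, by positivity]
  · rintro (i | ij)
    · exact Or.inl rfl
    · simp only [Sum.elim_inr]
      split_ifs
      exacts [Or.inr (Or.inl rfl), Or.inr (Or.inr rfl)]
  · rw [hp, gramPoly_eq_sum_diagDominant Q hQs]
    simp only [Fintype.sum_sum_type, Fintype.sum_prod_type, Sum.elim_inl, Sum.elim_inr, map_zero,
      zero_mul, add_zero]

/-- **Theorem 2 (Ahmadi–Majumdar).** `p` is dsos if and only if `p = z_Sᵀ Q z_S` for some finite set
`S` of monomials and some (symmetric) diagonally dominant matrix `Q`.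
[cite: AhmadiMajumdar2019, §3.1 Theorem 2 (dsos ⇔ p = zᵀQz with Q dd)] -/
theorem isDsos_iff_exists_isDiagDominant [DecidableEq σ] {p : MvPolynomial σ ℝ} :
    IsDsos p ↔ ∃ (S : Finset (σ →₀ ℕ)) (Q : Matrix S S ℝ), Q.IsSymm ∧ IsDiagDominant Q ∧
      p = gramPoly Q (monomialVec S) :=
  ⟨fun hp => hp.exists_isDiagDominant,
    fun ⟨S, _, h1, h2, h3⟩ => IsDsos.of_isDiagDominant (fun β : S => β.1) h1 h2 h3⟩

/-- **Theorem 2 (Ahmadi–Majumdar), as printed.** "A polynomial `p` of degree `2d` is dsos if and only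
if it admits a representation `p(x) = zᵀ(x) Q z(x)`, where `z(x)` is the standard monomial vector of
degree `≤ d` and `Q` is a dd matrix" (`z_d = monomialVec (monomialsLE σ d)`).
[cite: AhmadiMajumdar2019, §3.1 Theorem 2 (dsos ⇔ p = zᵀQz with Q dd)] -/
theorem isDsos_iff_exists_isDiagDominant_monomialsLE [Fintype σ] [DecidableEq σ]
    {p : MvPolynomial σ ℝ} {d : ℕ} (hd : p.totalDegree ≤ 2 * d) :
    IsDsos p ↔ ∃ Q : Matrix (monomialsLE σ d) (monomialsLE σ d) ℝ, Q.IsSymm ∧ IsDiagDominant Q ∧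
      p = gramPoly Q (monomialVec (monomialsLE σ d)) :=
  ⟨fun hp => hp.exists_isDiagDominant_monomialsLE hd,
    fun ⟨_, h1, h2, h3⟩ => IsDsos.of_isDiagDominant (fun β : monomialsLE σ d => β.1) h1 h2 h3⟩

/-! #### Theorem 3: sdsos ⇔ an sdd Gram matrix (factor width at most two) -/

/-- The coefficient vector of a binomial has at most two nonzero entries. [folklore] -/
@[folklore] private theorem card_binVec_ne_zero_le [DecidableEq σ] (S : Finset (σ →₀ ℕ)) (γ δ : σ →₀ ℕ)
    (a b : ℝ) : (univ.filter fun β : S => binVec S γ δ a b β ≠ 0).card ≤ 2 := by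
  refine le_trans ?_ (Finset.card_le_two (a := γ) (b := δ))
  refine Finset.card_le_card_of_injOn Subtype.val (fun β hβ => ?_)
    (Set.injOn_of_injective Subtype.val_injective)
  have hne : binVec S γ δ a b β ≠ 0 := (Finset.mem_filter.1 (Finset.mem_coe.1 hβ)).2
  simp only [Finset.coe_insert, Finset.coe_singleton, Set.mem_insert_iff, Set.mem_singleton_iff]
  by_contra h
  obtain ⟨h1, h2⟩ := not_or.1 h
  have h1' : ¬ γ = β.1 := fun h' => h1 h'.symm
  have h2' : ¬ δ = β.1 := fun h' => h2 h'.symm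
  exact hne (by simp [binVec, h1', h2'])

/-- **Theorem 3, "sdsos ⇒ Gram matrix of factor width 2", on any monomial set containing the
monomials used.**  `Σ_t (a_t X^{γ_t} + b_t X^{δ_t})² = z_Sᵀ (Σ_t w_t w_tᵀ) z_S` with each coefficient
vector `w_t` having at most two nonzero entries. [cite: AhmadiMajumdar2019, §3.1 Theorem 3 (sdsos ⇔ p = zᵀQz with Q sdd), ⇒ with Theorem 4] -/
theorem exists_hasFactorWidthTwo_of_binomials [DecidableEq σ] {T : Type*} [Fintype T]
    (γ δ : T → σ →₀ ℕ) (a b : T → ℝ) (S : Finset (σ →₀ ℕ))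
    (hS : ∀ t, (C (a t) * monomial (γ t) (1 : ℝ) + C (b t) * monomial (δ t) 1).support ⊆ S) :
    ∃ Q : Matrix S S ℝ, HasFactorWidthTwo Q ∧
      ∑ t, (C (a t) * monomial (γ t) 1 + C (b t) * monomial (δ t) 1) ^ 2 =
        gramPoly Q (monomialVec S) := by
  refine ⟨∑ t, (1 : ℝ) • vecMulVec (binVec S (γ t) (δ t) (a t) (b t))
    (binVec S (γ t) (δ t) (a t) (b t)), ?_, ?_⟩
  · refine HasFactorWidthTwo.of_sum_dyads (fun _ => (1 : ℝ)) (fun t => binVec S (γ t) (δ t) (a t) (b t))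
      (fun _ => zero_le_one) (fun t => card_binVec_ne_zero_le S _ _ _ _) fun i j => ?_
    simp only [Matrix.sum_apply, Matrix.smul_apply, vecMulVec_apply, smul_eq_mul]
  · rw [gramPoly_sum_smul_vecMulVec]
    refine Finset.sum_congr rfl fun t _ => ?_
    rw [← eq_sum_binVec (hS t), C_1, one_mul, sq]

/-- **Theorem 3, "sdsos ⇒ sdd Gram matrix".** An sdsos polynomial is `z_Sᵀ Q z_S` for some finite set
`S` of monomials and some `Q` of factor width at most two (equivalently symmetric sdd, Theorem 4).
[cite: AhmadiMajumdar2019, §3.1 Theorem 3 (sdsos ⇔ p = zᵀQz with Q sdd), ⇒] -/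
theorem IsSdsos.exists_hasFactorWidthTwo [DecidableEq σ] {p : MvPolynomial σ ℝ} (hp : IsSdsos p) :
    ∃ (S : Finset (σ →₀ ℕ)) (Q : Matrix S S ℝ), HasFactorWidthTwo Q ∧
      p = gramPoly Q (monomialVec S) := by
  obtain ⟨k, γ, δ, a, b, rfl⟩ := hp.exists_binomials
  exact ⟨_, exists_hasFactorWidthTwo_of_binomials γ δ a b
    (Finset.univ.biUnion fun t => (C (a t) * monomial (γ t) (1 : ℝ) + C (b t) * monomial (δ t) 1).support)
    fun t => Finset.subset_biUnion_of_mem (fun t => (C (a t) * monomial (γ t) (1 : ℝ) +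
      C (b t) * monomial (δ t) 1).support) (Finset.mem_univ t)⟩

/-- **The degree remark + Theorem 3 (⇒) with the standard monomial vector**: an sdsos `p` of degree
`≤ 2d` is `z_dᵀ Q z_d` with `Q` of factor width at most two, `z_d` = all monomials of degree `≤ d`
(each binomial `u_t` of `p = Σ_t u_t²` has `2 deg u_t ≤ deg p`).
[cite: AhmadiMajumdar2019, §3.1 Theorem 3 and the remark after Definition 2 (monomials of degree ≤ d suffice)] -/
theorem IsSdsos.exists_hasFactorWidthTwo_monomialsLE [Fintype σ] [DecidableEq σ]
    {p : MvPolynomial σ ℝ} {d : ℕ} (hp : IsSdsos p) (hd : p.totalDegree ≤ 2 * d) :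
    ∃ Q : Matrix (monomialsLE σ d) (monomialsLE σ d) ℝ, HasFactorWidthTwo Q ∧
      p = gramPoly Q (monomialVec (monomialsLE σ d)) := by
  obtain ⟨k, γ, δ, a, b, rfl⟩ := hp.exists_binomials
  have hsq : ∑ t, (C (a t) * monomial (γ t) (1 : ℝ) + C (b t) * monomial (δ t) 1) ^ 2 =
      ∑ t, (C (a t) * monomial (γ t) (1 : ℝ) + C (b t) * monomial (δ t) 1) *
        (C (a t) * monomial (γ t) (1 : ℝ) + C (b t) * monomial (δ t) 1) :=
    Finset.sum_congr rfl fun t _ => sq _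
  refine exists_hasFactorWidthTwo_of_binomials γ δ a b (monomialsLE σ d) fun t => ?_
  have h2 := two_mul_totalDegree_le_of_sum_mul_self_eq _ hsq t
  exact support_subset_monomialsLE (by omega)

/-- Covering the support of a vector with at most two nonzero entries by a pair of indices. [folklore] -/
@[folklore] private theorem exists_pair_of_card_le_two [Nonempty ι] {v : ι → ℝ}
    (hv : (univ.filter fun i => v i ≠ 0).card ≤ 2) : ∃ a b : ι, ∀ i, v i ≠ 0 → i = a ∨ i = b := by
  set F := univ.filter fun i => v i ≠ 0 with hF
  have hmem : ∀ i, v i ≠ 0 → i ∈ F := fun i hi => Finset.mem_filter.2 ⟨Finset.mem_univ _, hi⟩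
  rcases F.eq_empty_or_nonempty with h0 | ⟨a, ha⟩
  · refine ⟨Classical.arbitrary ι, Classical.arbitrary ι, fun i hi => ?_⟩
    have := hmem i hi
    rw [h0] at this
    exact absurd this (Finset.notMem_empty i)
  · have hcard : (F.erase a).card ≤ 1 := by rw [Finset.card_erase_of_mem ha]; omega
    rcases (F.erase a).eq_empty_or_nonempty with h1 | ⟨b, hb⟩
    · refine ⟨a, a, fun i hi => Or.inl ?_⟩
      by_contra hia
      have := Finset.mem_erase.2 ⟨hia, hmem i hi⟩
      rw [h1] at this
      exact absurd this (Finset.notMem_empty i)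
    · refine ⟨a, b, fun i hi => ?_⟩
      by_cases hia : i = a
      · exact Or.inl hia
      · exact Or.inr (Finset.card_le_one.1 hcard i (Finset.mem_erase.2 ⟨hia, hmem i hi⟩) b hb)

omit [DecidableEq ι] in
/-- **Theorem 3, "sdd Gram matrix ⇒ sdsos".** If `p = zᵀ Q z` for a vector `z` of monomials and a
matrix `Q` of factor width at most two (`Q = Σ_t v_t v_tᵀ`, each `v_t` with at most two nonzero
entries), then `p = Σ_t (v_t · z)²` is a sum of binomial squares, i.e. sdsos.
[cite: AhmadiMajumdar2019, §3.1 Theorem 3 (sdsos ⇔ p = zᵀQz with Q sdd), ⇐ with Theorem 4] -/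
theorem IsSdsos.of_hasFactorWidthTwo (m : ι → σ →₀ ℕ) {Q : Matrix ι ι ℝ} (hQ : HasFactorWidthTwo Q)
    {p : MvPolynomial σ ℝ} (hp : p = gramPoly Q fun i => monomial (m i) 1) : IsSdsos p := by
  classical
  obtain ⟨K, v, hv, hQv⟩ := hQ.exists_dyads
  have hQ' : Q = ∑ t, (1 : ℝ) • vecMulVec (v t) (v t) := by
    ext i j
    simp [Matrix.sum_apply, vecMulVec_apply, hQv i j]
  rw [hQ', gramPoly_sum_smul_vecMulVec] at hp
  rcases isEmpty_or_nonempty ι with hι | hι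
  · have h0 : p = 0 := by rw [hp]; simp
    rw [h0]
    exact isSdsos_zero
  have hpair : ∀ t, ∃ ab : ι × ι, ∀ i, v t i ≠ 0 → i = ab.1 ∨ i = ab.2 := fun t => by
    obtain ⟨a, b, h⟩ := exists_pair_of_card_le_two (hv t)
    exact ⟨(a, b), h⟩
  choose ab hab using hpair
  refine IsSdsos.of_binomials (fun t => m (ab t).1) (fun t => m (ab t).2) (fun t => v t (ab t).1)
    (fun t => if (ab t).2 = (ab t).1 then 0 else v t (ab t).2) ?_
  rw [hp]
  refine Finset.sum_congr rfl fun t _ => ?_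
  have hlin : ∑ j, C (v t j) * monomial (m j) (1 : ℝ) =
      C (v t (ab t).1) * monomial (m (ab t).1) 1 +
        C (if (ab t).2 = (ab t).1 then 0 else v t (ab t).2) * monomial (m (ab t).2) 1 := by
    rw [← Finset.sum_subset (Finset.subset_univ ({(ab t).1, (ab t).2} : Finset ι))
      fun j _ hj => ?_]
    · by_cases h : (ab t).2 = (ab t).1
      · rw [h, Finset.pair_eq_singleton, Finset.sum_singleton, if_pos rfl, map_zero, zero_mul,
          add_zero]
      · rw [Finset.sum_pair (Ne.symm h), if_neg h]
    · have h0 : v t j = 0 := by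
        by_contra hne
        rcases hab t j hne with h | h <;> simp [h] at hj
      rw [h0, map_zero, zero_mul]
  rw [map_one, one_mul, hlin, sq]

/-- **Theorem 3 via Theorem 4, "sdd Gram matrix ⇒ sdsos"**: a symmetric scaled-diagonally-dominant
Gram matrix on any family of monomials gives an sdsos polynomial.
[cite: AhmadiMajumdar2019, §3.1 Theorem 3 (sdsos ⇔ p = zᵀQz with Q sdd), ⇐] -/
theorem IsSdsos.of_isScaledDiagDominant (m : ι → σ →₀ ℕ) {Q : Matrix ι ι ℝ} (hQs : Q.IsSymm)
    (hQ : IsScaledDiagDominant Q) {p : MvPolynomial σ ℝ}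
    (hp : p = gramPoly Q fun i => monomial (m i) 1) : IsSdsos p :=
  IsSdsos.of_hasFactorWidthTwo m ((hasFactorWidthTwo_iff_isScaledDiagDominant hQs).2 hQ) hp

/-- **Theorem 3 (Ahmadi–Majumdar), factor-width form.** `p` is sdsos iff `p = z_Sᵀ Q z_S` for some
finite set `S` of monomials and some `Q` of factor width at most two.
[cite: AhmadiMajumdar2019, §3.1 Theorem 3 with Theorem 4 (sdd ⇔ factor width ≤ 2)] -/
theorem isSdsos_iff_exists_hasFactorWidthTwo [DecidableEq σ] {p : MvPolynomial σ ℝ} :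
    IsSdsos p ↔ ∃ (S : Finset (σ →₀ ℕ)) (Q : Matrix S S ℝ), HasFactorWidthTwo Q ∧
      p = gramPoly Q (monomialVec S) :=
  ⟨fun hp => hp.exists_hasFactorWidthTwo,
    fun ⟨S, _, h1, h2⟩ => IsSdsos.of_hasFactorWidthTwo (fun β : S => β.1) h1 h2⟩

/-- **Theorem 3 (Ahmadi–Majumdar).** `p` is sdsos iff `p = z_Sᵀ Q z_S` for some finite set `S` of
monomials and some symmetric scaled-diagonally-dominant `Q`.
[cite: AhmadiMajumdar2019, §3.1 Theorem 3 (sdsos ⇔ p = zᵀQz with Q sdd)] -/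
theorem isSdsos_iff_exists_isScaledDiagDominant [DecidableEq σ] {p : MvPolynomial σ ℝ} :
    IsSdsos p ↔ ∃ (S : Finset (σ →₀ ℕ)) (Q : Matrix S S ℝ), Q.IsSymm ∧ IsScaledDiagDominant Q ∧
      p = gramPoly Q (monomialVec S) := by
  rw [isSdsos_iff_exists_hasFactorWidthTwo]
  refine exists_congr fun S => ⟨fun ⟨Q, h1, h2⟩ => ⟨Q, h1.isSymm,
    (hasFactorWidthTwo_iff_isScaledDiagDominant h1.isSymm).1 h1, h2⟩,
    fun ⟨Q, h0, h1, h2⟩ => ⟨Q, (hasFactorWidthTwo_iff_isScaledDiagDominant h0).2 h1, h2⟩⟩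

/-- **Theorem 3 (Ahmadi–Majumdar), as printed.** "A polynomial `p` of degree `2d` is sdsos if and
only if it admits a representation as `p(x) = zᵀ(x) Q z(x)`, where `z(x)` is the standard monomial
vector of degree `≤ d` and `Q` is a sdd matrix."
[cite: AhmadiMajumdar2019, §3.1 Theorem 3 (sdsos ⇔ p = zᵀQz with Q sdd)] -/
theorem isSdsos_iff_exists_isScaledDiagDominant_monomialsLE [Fintype σ] [DecidableEq σ]
    {p : MvPolynomial σ ℝ} {d : ℕ} (hd : p.totalDegree ≤ 2 * d) :
    IsSdsos p ↔ ∃ Q : Matrix (monomialsLE σ d) (monomialsLE σ d) ℝ, Q.IsSymm ∧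
      IsScaledDiagDominant Q ∧ p = gramPoly Q (monomialVec (monomialsLE σ d)) :=
  ⟨fun hp => by
      obtain ⟨Q, h1, h2⟩ := hp.exists_hasFactorWidthTwo_monomialsLE hd
      exact ⟨Q, h1.isSymm, (hasFactorWidthTwo_iff_isScaledDiagDominant h1.isSymm).1 h1, h2⟩,
    fun ⟨_, h0, h1, h2⟩ => IsSdsos.of_isScaledDiagDominant (fun β : monomialsLE σ d => β.1) h0 h1 h2⟩

end Gram

/-! ### The hierarchy of r-dsos / r-sdsos polynomials (Definition 4), nonnegativity (3.3), Theorem 7 -/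

section Hierarchy

variable [Fintype σ]

/-- **Definition 4 (r-dsos).** For an integer `r ≥ 0`, `p` is *r-dsos* if `p · (Σ_i x_i²)^r` is dsos.
[cite: AhmadiMajumdar2019, §3.2 Definition 4 (r-dsos and r-sdsos polynomials)] -/
def IsRDsos (r : ℕ) (p : MvPolynomial σ ℝ) : Prop := IsDsos (p * (∑ i, X i ^ 2) ^ r)

/-- **Definition 4 (r-sdsos).** For an integer `r ≥ 0`, `p` is *r-sdsos* if `p · (Σ_i x_i²)^r` is
sdsos. [cite: AhmadiMajumdar2019, §3.2 Definition 4 (r-dsos and r-sdsos polynomials)] -/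
def IsRSdsos (r : ℕ) (p : MvPolynomial σ ℝ) : Prop := IsSdsos (p * (∑ i, X i ^ 2) ^ r)

/-- `rDSOS ⊆ rSDSOS`. [cite: AhmadiMajumdar2019, §3.2 display (3.3) (rDSOS_{n,2d} ⊆ rSDSOS_{n,2d} ⊆ PSD_{n,2d})] -/
theorem IsRDsos.isRSdsos {r : ℕ} {p : MvPolynomial σ ℝ} (h : IsRDsos r p) : IsRSdsos r p :=
  IsDsos.isSdsos h

/-- "For `r = 0` we recover our dsos definition." [cite: AhmadiMajumdar2019, §3.2, remark after Definition 4] -/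
theorem isRDsos_zero_iff {p : MvPolynomial σ ℝ} : IsRDsos 0 p ↔ IsDsos p := by
  simp [IsRDsos]

/-- "For `r = 0` we recover our sdsos definition." [cite: AhmadiMajumdar2019, §3.2, remark after Definition 4] -/
theorem isRSdsos_zero_iff {p : MvPolynomial σ ℝ} : IsRSdsos 0 p ↔ IsSdsos p := by
  simp [IsRSdsos]

/-- The r-dsos levels are nested: multiplying a dsos certificate by `Σ_i x_i² = Σ_i (x_i)²` keeps it
dsos (each `x_i²`-multiple of a dsos polynomial is dsos), so r-dsos ⇒ (r+1)-dsos.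
[cite: AhmadiMajumdar2019, §3.2 Definition 4 ("a hierarchy of cones")] -/
theorem IsRDsos.succ {r : ℕ} {p : MvPolynomial σ ℝ} (h : IsRDsos r p) : IsRDsos (r + 1) p := by
  unfold IsRDsos at *
  rw [pow_succ, ← mul_assoc, Finset.mul_sum]
  exact IsDsos.sum _ fun i _ => h.mul_monomial_sq (Finsupp.single i 1)

/-- The r-sdsos levels are nested: r-sdsos ⇒ (r+1)-sdsos.
[cite: AhmadiMajumdar2019, §3.2 Definition 4 ("a hierarchy of cones")] -/
theorem IsRSdsos.succ {r : ℕ} {p : MvPolynomial σ ℝ} (h : IsRSdsos r p) : IsRSdsos (r + 1) p := by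
  unfold IsRSdsos at *
  rw [pow_succ, ← mul_assoc, Finset.mul_sum]
  exact IsSdsos.sum _ fun i _ => h.mul_monomial_sq (Finsupp.single i 1)

/-- Monotonicity of the r-dsos hierarchy in `r`. [cite: AhmadiMajumdar2019, §3.2 Definition 4 ("a hierarchy of cones")] -/
theorem IsRDsos.mono {r s : ℕ} {p : MvPolynomial σ ℝ} (h : IsRDsos r p) (hrs : r ≤ s) : IsRDsos s p := by
  induction s, hrs using Nat.le_induction with
  | base => exact h
  | succ s _ ih => exact ih.succ

/-- Monotonicity of the r-sdsos hierarchy in `r`. [cite: AhmadiMajumdar2019, §3.2 Definition 4 ("a hierarchy of cones")] -/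
theorem IsRSdsos.mono {r s : ℕ} {p : MvPolynomial σ ℝ} (h : IsRSdsos r p) (hrs : r ≤ s) :
    IsRSdsos s p := by
  induction s, hrs using Nat.le_induction with
  | base => exact h
  | succ s _ ih => exact ih.succ

/-- **(3.3): r-sdsos ⇒ nonnegative** (in at least one variable). "Because the multiplier
`(Σ_i x_i²)^r` is nonnegative, for any `r` the property of being r-dsos or r-sdsos is a sufficient
condition for nonnegativity": at `x ≠ 0` divide the nonnegativity of the sdsos product by
`(Σ x_i²)^r > 0`, and `x = 0` follows by continuity.  (With no variables and `r ≥ 1` the multiplier is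
`0` and the statement fails for a negative constant, whence `[Nonempty σ]`.)
[cite: AhmadiMajumdar2019, §3.2 display (3.3) (rSDSOS_{n,2d} ⊆ PSD_{n,2d})] -/
theorem IsRSdsos.eval_nonneg [Nonempty σ] {r : ℕ} {p : MvPolynomial σ ℝ} (h : IsRSdsos r p)
    (x : σ → ℝ) : 0 ≤ eval x p := by
  have key : ∀ y : σ → ℝ, y ≠ 0 → 0 ≤ eval y p := by
    intro y hy
    obtain ⟨i, hi⟩ := Function.ne_iff.1 hy
    have hq : 0 < eval y ((∑ i, X i ^ 2) ^ r : MvPolynomial σ ℝ) := by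
      rw [map_pow]
      refine pow_pos ?_ r
      simp only [map_sum, map_pow, eval_X]
      exact lt_of_lt_of_le (lt_of_le_of_ne (sq_nonneg (y i)) (Ne.symm (pow_ne_zero 2 hi)))
        (Finset.single_le_sum (fun j _ => sq_nonneg (y j)) (Finset.mem_univ i))
    have h1 : 0 ≤ eval y (p * (∑ i, X i ^ 2) ^ r) := IsSdsos.eval_nonneg h y
    rw [map_mul] at h1
    exact (mul_nonneg_iff_of_pos_right hq).1 h1
  have hclosed : IsClosed {y : σ → ℝ | 0 ≤ eval y p} :=
    isClosed_le continuous_const (MvPolynomial.continuous_eval p)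
  have hx : x ∈ closure ({0}ᶜ : Set (σ → ℝ)) := by
    rw [(dense_compl_singleton (0 : σ → ℝ)).closure_eq]
    trivial
  exact hclosed.closure_subset_iff.2 (fun y hy => key y hy) hx

/-- **(3.3): r-dsos ⇒ nonnegative.** [cite: AhmadiMajumdar2019, §3.2 display (3.3) (rDSOS_{n,2d} ⊆ PSD_{n,2d})] -/
theorem IsRDsos.eval_nonneg [Nonempty σ] {r : ℕ} {p : MvPolynomial σ ℝ} (h : IsRDsos r p)
    (x : σ → ℝ) : 0 ≤ eval x p :=
  h.isRSdsos.eval_nonneg x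

omit [Fintype σ] in
/-- A polynomial in the squared variables with nonnegative coefficients is dsos: `Σ_β c_β (x^β)²`
with `c_β ≥ 0` is "a nonnegative weighted sum of squared monomials and therefore clearly dsos"
(the first sum of (eq:dsos); "we can take `Q` to be diagonal").
[cite: AhmadiMajumdar2019, §3.2 proof of Theorem 7 (last step)] -/
theorem isDsos_expand_two_of_coeff_nonneg (G : MvPolynomial σ ℝ) (hG : ∀ β, 0 ≤ coeff β G) :
    IsDsos (expand 2 G) := by
  have hexp : expand 2 G =
      ∑ β ∈ G.support, C (coeff β G) * (monomial β (1 : ℝ) + C 0 * monomial β 1) ^ 2 := by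
    conv_lhs => rw [G.as_sum, map_sum]
    refine Finset.sum_congr rfl fun β _ => ?_
    rw [expand_monomial, map_zero, zero_mul, add_zero, monomial_pow, one_pow, C_mul_monomial,
      mul_one]
  rw [hexp, ← Finset.sum_coe_sort]
  exact IsDsos.of_terms (fun β : G.support => β.1) (fun β => β.1) (fun β => coeff β.1 G)
    (fun _ => 0) (fun β => hG _) (fun _ => Or.inl rfl) rfl

omit [Fintype σ] in
/-- Halving the exponents of an even monomial (plumbing for Theorem 7: `p(x) = q(x²)`). [folklore] -/
@[folklore] private def halfExp (γ : σ →₀ ℕ) : σ →₀ ℕ := γ.mapRange (· / 2) (by simp)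

omit [Fintype σ] in
/-- `2 • halfExp γ = γ` for an even exponent `γ`. [folklore] -/
@[folklore] private theorem two_nsmul_halfExp {γ : σ →₀ ℕ} (h : ∀ i, Even (γ i)) : 2 • halfExp γ = γ :=
  Finsupp.ext fun i => by
    simp only [halfExp, Finsupp.smul_apply, Finsupp.mapRange_apply, smul_eq_mul]
    exact Nat.two_mul_div_two_of_even (h i)

/-- **Theorem 7 (Ahmadi–Majumdar).** "Let `p` be an even positive definite form. Then there exists an
integer `r` for which `p` is r-dsos (and hence r-sdsos)."  Proof as printed: write `p(x) = q(x²)`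
(evenness); `q` is a form positive on the simplex (positive definiteness of `p` at `√x`), so by
Pólya's theorem (`Literature.Algebra.Polynomial.polya`) all coefficients of `(x_1+⋯+x_n)^r q` are
positive for some `r`; substituting `x_i ↦ x_i²`, `p(x)·(Σ x_i²)^r` is a nonnegative combination of
squared monomials, hence dsos.
[cite: AhmadiMajumdar2019, §3.2 Theorem 7 (even pd forms are r-dsos for some r); Polya1928] -/
theorem exists_isRDsos_of_even_posDef (p : MvPolynomial σ ℝ) {D : ℕ} (hhom : p.IsHomogeneous (2 * D))
    (heven : ∀ γ ∈ p.support, ∀ i, Even (γ i)) (hpd : ∀ x : σ → ℝ, x ≠ 0 → 0 < eval x p) :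
    ∃ r, IsRDsos r p := by
  classical
  -- `p = q(x²)`
  set q : MvPolynomial σ ℝ := ∑ γ ∈ p.support, monomial (halfExp γ) (coeff γ p) with hq_def
  have hpq : p = expand 2 q := by
    rw [hq_def, map_sum]
    conv_lhs => rw [p.as_sum]
    exact Finset.sum_congr rfl fun γ hγ => by rw [expand_monomial, two_nsmul_halfExp (heven γ hγ)]
  have hqhom : q.IsHomogeneous D := by
    refine IsHomogeneous.sum _ _ _ fun γ hγ => isHomogeneous_monomial _ ?_
    have hdeg : Finsupp.degree γ = 2 * D := by
      by_contra hne
      exact (mem_support_iff.1 hγ) (hhom.coeff_eq_zero hne)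
    have h2 : Finsupp.degree (2 • halfExp γ) = 2 * D := by rw [two_nsmul_halfExp (heven γ hγ), hdeg]
    rw [map_nsmul, smul_eq_mul] at h2
    omega
  have hqpos : ∀ y ∈ stdSimplex ℝ σ, 0 < eval y q := by
    intro y hy
    have hx : (fun i => √(y i)) ≠ 0 := by
      intro h0
      have hsum : ∑ i, y i = 0 := Finset.sum_eq_zero fun i _ => by
        have := congr_fun h0 i
        exact (Real.sqrt_eq_zero (hy.1 i)).1 this
      rw [hy.2] at hsum
      exact one_ne_zero hsum
    have := hpd _ hx
    rw [hpq, eval_expand] at this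
    convert this using 3
    funext i
    simp [Real.sq_sqrt (hy.1 i)]
  obtain ⟨N₀, hN₀⟩ := polya q hqhom hqpos
  refine ⟨N₀, ?_⟩
  -- `G = (Σ x_i)^{N₀} q` has nonnegative coefficients and `p (Σ x_i²)^{N₀} = G(x²)`
  have hGhom : ((∑ i, X i) ^ N₀ * q : MvPolynomial σ ℝ).IsHomogeneous (1 * N₀ + D) :=
    ((IsHomogeneous.sum univ (fun i => (X i : MvPolynomial σ ℝ)) 1
      fun i _ => isHomogeneous_X ℝ i).pow N₀).mul hqhom
  have hGcoeff : ∀ β, 0 ≤ coeff β ((∑ i, X i) ^ N₀ * q : MvPolynomial σ ℝ) := by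
    intro β
    by_cases hβ : Finsupp.degree β = N₀ + D
    · exact (hN₀ N₀ le_rfl β hβ).le
    · rw [hGhom.coeff_eq_zero (by omega)]
  have hexp : p * (∑ i, X i ^ 2) ^ N₀ = expand 2 ((∑ i, X i) ^ N₀ * q) := by
    rw [map_mul, map_pow, map_sum, ← hpq]
    simp only [expand_X]
    ring
  show IsDsos (p * (∑ i, X i ^ 2) ^ N₀)
  rw [hexp]
  exact isDsos_expand_two_of_coeff_nonneg _ hGcoeff

/-- **Theorem 7, sdsos form** ("and hence r-sdsos"). [cite: AhmadiMajumdar2019, §3.2 Theorem 7] -/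
theorem exists_isRSdsos_of_even_posDef (p : MvPolynomial σ ℝ) {D : ℕ}
    (hhom : p.IsHomogeneous (2 * D)) (heven : ∀ γ ∈ p.support, ∀ i, Even (γ i))
    (hpd : ∀ x : σ → ℝ, x ≠ 0 → 0 < eval x p) : ∃ r, IsRSdsos r p := by
  obtain ⟨r, hr⟩ := exists_isRDsos_of_even_posDef p hhom heven hpd
  exact ⟨r, hr.isRSdsos⟩

/-- **Theorem 7 with the Powers–Reznick degree bound: an effective r-dsos certificate.**  Let
`p(x) = q(x²)` (`p = expand 2 q`) be an even form, `q` a form of degree `D` whose coefficients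
satisfy `|q_α| ≤ L · D!/α!` for all `α`, and `q ≥ λ` on the simplex `Δ`.  If
`λ · (r + D) > L · C(D,2)` (i.e. `r > C(D,2) L/λ − D`), then `p` is r-dsos.  This is the printed proof
of Theorem 7 run with the Powers–Reznick bound (`Literature.Algebra.Polynomial.polya_powersReznick`,
[PowersReznick2001, Thm 1]) in place of Pólya's qualitative theorem: every coefficient of
`(Σ yᵢ)^r q` is then positive, so `p · (Σ xᵢ²)^r = ((Σ yᵢ)^r q)(x²)` is a nonnegative combination of
squared monomials, hence dsos (`isDsos_expand_two_of_coeff_nonneg`).  The source states Theorem 7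
without a bound on `r`; the bound is the one its proof yields with [PowersReznick2001] as the Pólya step.
[cite: AhmadiMajumdar2019, §3.2 Theorem 7 (proof: Pólya's theorem applied to q, p(x) = q(x²))]
[cite: PowersReznick2001, Thm 1] -/
theorem isRDsos_expand_two_of_abs_coeff_le (q : MvPolynomial σ ℝ) {D : ℕ} (hq : q.IsHomogeneous D)
    {L lam : ℝ} (hL : ∀ α, |coeff α q| ≤ L * (α.multinomial : ℝ))
    (hpos : ∀ y ∈ stdSimplex ℝ σ, lam ≤ eval y q) {r : ℕ}
    (hr : L * (D.choose 2 : ℝ) < lam * (r + D : ℝ)) : IsRDsos r (expand 2 q) := by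
  classical
  have hGhom : ((∑ i, X i) ^ r * q : MvPolynomial σ ℝ).IsHomogeneous (1 * r + D) :=
    ((IsHomogeneous.sum univ (fun i => (X i : MvPolynomial σ ℝ)) 1
      fun i _ => isHomogeneous_X ℝ i).pow r).mul hq
  have hGcoeff : ∀ β, 0 ≤ coeff β ((∑ i, X i) ^ r * q : MvPolynomial σ ℝ) := by
    intro β
    by_cases hβ : Finsupp.degree β = r + D
    · exact (polya_powersReznick q hq hL hpos hr β hβ).le
    · rw [hGhom.coeff_eq_zero (by omega)]
  have hexp : expand 2 q * (∑ i, X i ^ 2) ^ r = expand 2 ((∑ i, X i) ^ r * q) := by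
    rw [map_mul, map_pow, map_sum]
    simp only [expand_X]
    ring
  show IsDsos (expand 2 q * (∑ i, X i ^ 2) ^ r)
  rw [hexp]
  exact isDsos_expand_two_of_coeff_nonneg _ hGcoeff

/-- On the unit sphere `p(x) = q(x²)` takes exactly the values of `q` on the simplex: a lower bound
`λ ≤ p` on `{Σ xᵢ² = 1}` is a lower bound `λ ≤ q` on `Δ` (take `xᵢ = √yᵢ`).
[cite: AhmadiMajumdar2019, §3.2 proof of Theorem 7 («the form p(√x₁, …, √xₙ)»)] -/
theorem le_eval_of_le_eval_expand_two_sphere (q : MvPolynomial σ ℝ) {lam : ℝ}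
    (hpos : ∀ x : σ → ℝ, ∑ i, x i ^ 2 = 1 → lam ≤ eval x (expand 2 q)) :
    ∀ y ∈ stdSimplex ℝ σ, lam ≤ eval y q := by
  intro y hy
  have h := hpos (fun i => √(y i)) (by
    rw [← hy.2]; exact Finset.sum_congr rfl fun i _ => Real.sq_sqrt (hy.1 i))
  rw [eval_expand] at h
  convert h using 3
  funext i
  simp [Real.sq_sqrt (hy.1 i)]

/-- **Theorem 7, effective, with the hypothesis on the sphere**: `p = q(x²)`, `q` a form of degree
`D` with `|q_α| ≤ L · D!/α!`, `p ≥ λ` on the unit sphere, `λ (r + D) > L · C(D,2)` ⇒ `p` is r-dsos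
and r-sdsos. [cite: AhmadiMajumdar2019, §3.2 Theorem 7 (proof)] [cite: PowersReznick2001, Thm 1] -/
theorem isRDsos_expand_two_of_le_eval_sphere (q : MvPolynomial σ ℝ) {D : ℕ}
    (hq : q.IsHomogeneous D) {L lam : ℝ} (hL : ∀ α, |coeff α q| ≤ L * (α.multinomial : ℝ))
    (hpos : ∀ x : σ → ℝ, ∑ i, x i ^ 2 = 1 → lam ≤ eval x (expand 2 q)) {r : ℕ}
    (hr : L * (D.choose 2 : ℝ) < lam * (r + D : ℝ)) :
    IsRDsos r (expand 2 q) ∧ IsRSdsos r (expand 2 q) :=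
  have h := isRDsos_expand_two_of_abs_coeff_le q hq hL
    (le_eval_of_le_eval_expand_two_sphere q hpos) hr
  ⟨h, h.isRSdsos⟩

end Hierarchy

/-! ### Proposition 1: evenness cannot be dropped — a separating functional for the sdsos cone

"For a form `f`, construct a vector `v_f` with an entry per monomial, `+1` if the monomial is even and
`−1` if it is not. If `f` is sdsos then the inner product of its coefficients with `v_f` is
nonnegative."  We formalise the functional `evenSignForm f = Σ_γ v_f(γ) · coeff_γ f`, prove its
nonnegativity on sdsos polynomials directly from (eq:sdsos), identify it with a signed cube average
`2^n · evenSignForm f = 2 Σ_{ε ∈ {±1}^n} f(ε) − 2^n f(1,…,1)` (the device used to evaluate it on the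
family `f_r = p · (Σ x_i²)^r`), and deduce Proposition 1. -/

section Separation

variable [Fintype σ]

/-- `v_f(γ)`: `+1` if the monomial `x^γ` is even (every exponent even), `−1` otherwise.
[cite: AhmadiMajumdar2019, §3.2 proof of Proposition 1 (the vector v_f)] -/
def evenSign (γ : σ →₀ ℕ) : ℝ := if ∀ i, Even (γ i) then 1 else -1

omit [Fintype σ] in
/-- The defining sum of the functional may be taken over any finite set containing the support
(plumbing). [folklore] -/
@[folklore] private theorem sum_evenSign_mul_coeff_eq [Fintype σ] (f : MvPolynomial σ ℝ) {S : Finset (σ →₀ ℕ)}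
    (h : f.support ⊆ S) : ∑ γ ∈ f.support, evenSign γ * coeff γ f = ∑ γ ∈ S, evenSign γ * coeff γ f :=
  Finset.sum_subset h fun γ _ hγ => by rw [notMem_support_iff.1 hγ, mul_zero]

/-- **The separating functional of Proposition 1**: `f ↦ ⟨coefficients of f, v_f⟩ =
Σ_γ v_f(γ) coeff_γ(f)`, as an additive map. [cite: AhmadiMajumdar2019, §3.2 proof of Proposition 1 ("a general separating hyperplane for the cone of sdsos forms in any degree and dimension")] -/
def evenSignForm : MvPolynomial σ ℝ →+ ℝ where
  toFun f := ∑ γ ∈ f.support, evenSign γ * coeff γ f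
  map_zero' := by simp
  map_add' f g := by
    classical
    rw [sum_evenSign_mul_coeff_eq (f + g) support_add,
      sum_evenSign_mul_coeff_eq f (Finset.subset_union_left (s₂ := g.support)),
      sum_evenSign_mul_coeff_eq g (Finset.subset_union_right (s₁ := f.support)),
      ← Finset.sum_add_distrib]
    exact Finset.sum_congr rfl fun γ _ => by rw [coeff_add, mul_add]

/-- Unfolding `evenSignForm f = Σ_{γ ∈ supp f} v_f(γ) coeff_γ(f)`. [cite: AhmadiMajumdar2019, §3.2 proof of Proposition 1] -/
theorem evenSignForm_apply (f : MvPolynomial σ ℝ) :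
    evenSignForm f = ∑ γ ∈ f.support, evenSign γ * coeff γ f := rfl

/-- On a monomial the functional is `v_f(γ) · c`. [cite: AhmadiMajumdar2019, §3.2 proof of Proposition 1] -/
theorem evenSignForm_monomial (γ : σ →₀ ℕ) (c : ℝ) : evenSignForm (monomial γ c) = evenSign γ * c := by
  classical
  rw [evenSignForm_apply, sum_evenSign_mul_coeff_eq _ support_monomial_subset, Finset.sum_singleton,
    coeff_monomial, if_pos rfl]

/-- `x^{2γ}` is an even monomial, so `v_f` assigns it `+1`. [cite: AhmadiMajumdar2019, §3.2 proof of Proposition 1] -/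
theorem evenSign_add_self (γ : σ →₀ ℕ) : evenSign (γ + γ) = 1 :=
  if_pos fun i => ⟨γ i, Finsupp.add_apply γ γ i⟩

/-- The functional is nonnegative on every binomial square `(a x^γ + b x^δ)² =
a² x^{2γ} + 2ab x^{γ+δ} + b² x^{2δ}`: its value is `a² ± 2ab + b² = (a ± b)²` according to whether
`x^{γ+δ}` is even ("flipping the sign of the non-even monomials" keeps a binomial square a binomial
square). [cite: AhmadiMajumdar2019, §3.2 proof of Proposition 1 ("straightforward to see from the expansion in (eq:sdsos)")] -/
theorem evenSignForm_binomial_sq_nonneg (γ δ : σ →₀ ℕ) (a b : ℝ) :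
    0 ≤ evenSignForm ((C a * monomial γ (1 : ℝ) + C b * monomial δ 1) ^ 2) := by
  have hexp : (C a * monomial γ (1 : ℝ) + C b * monomial δ 1) ^ 2 =
      monomial (γ + γ) (a * a) + (monomial (γ + δ) (a * b + a * b) + monomial (δ + δ) (b * b)) := by
    rw [C_mul_monomial, C_mul_monomial, mul_one, mul_one, sq, add_mul, mul_add, mul_add,
      monomial_mul, monomial_mul, monomial_mul, monomial_mul, map_add, add_comm δ γ, mul_comm b a]
    abel
  rw [hexp, map_add, map_add, evenSignForm_monomial, evenSignForm_monomial, evenSignForm_monomial,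
    evenSign_add_self, evenSign_add_self]
  unfold evenSign
  split_ifs
  · nlinarith [sq_nonneg (a + b)]
  · nlinarith [sq_nonneg (a - b)]

/-- **Proposition 1, the separating hyperplane.** "If `f` is sdsos, then the (standard) inner
product of its coefficients with `v_f` is nonnegative."
[cite: AhmadiMajumdar2019, §3.2 proof of Proposition 1] -/
theorem IsSdsos.evenSignForm_nonneg {f : MvPolynomial σ ℝ} (h : IsSdsos f) : 0 ≤ evenSignForm f := by
  obtain ⟨k, γ, δ, a, b, rfl⟩ := h.exists_binomials
  rw [map_sum]
  exact Finset.sum_nonneg fun t _ => evenSignForm_binomial_sq_nonneg _ _ _ _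

/-- **The family of Proposition 1** in `n` variables: `p_a(x) = (Σ_i x_i)² + a Σ_i x_i²`.
[cite: AhmadiMajumdar2019, §3.2 Proposition 1, display (the quadratic form p)] -/
def amForm (a : ℝ) : MvPolynomial σ ℝ := (∑ i, X i) ^ 2 + C a * ∑ i, X i ^ 2

/-- `p_a` is positive definite for `a > 0` ("immediate from having `a > 0`").
[cite: AhmadiMajumdar2019, §3.2 Proposition 1 (positive definite)] -/
theorem amForm_posDef {a : ℝ} (ha : 0 < a) (x : σ → ℝ) (hx : x ≠ 0) : 0 < eval x (amForm a) := by
  obtain ⟨i, hi⟩ := Function.ne_iff.1 hx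
  simp only [amForm, map_add, map_pow, map_sum, map_mul, eval_C, eval_X]
  have hsq : 0 < ∑ j, x j ^ 2 :=
    lt_of_lt_of_le (lt_of_le_of_ne (sq_nonneg (x i)) (Ne.symm (pow_ne_zero 2 hi)))
      (Finset.single_le_sum (fun j _ => sq_nonneg (x j)) (Finset.mem_univ i))
  nlinarith [sq_nonneg (∑ j, x j)]

/-- `f_r(1,…,1) = (n² + a n) n^r` for `f_r = p_a · (Σ x_i²)^r`, the forms tested in the proof of
Proposition 1. [cite: AhmadiMajumdar2019, §3.2 proof of Proposition 1 (latter claim, `p·(Σ x_i²)^r`)] -/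
theorem eval_one_amForm_mul (a : ℝ) (r : ℕ) :
    eval (fun _ => (1 : ℝ)) (amForm a * (∑ i, X i ^ 2) ^ r : MvPolynomial σ ℝ) =
      ((Fintype.card σ : ℝ) ^ 2 + a * Fintype.card σ) * (Fintype.card σ : ℝ) ^ r := by
  simp only [amForm, map_mul, map_add, map_pow, map_sum, eval_C, eval_X, one_pow, Finset.sum_const,
    Finset.card_univ, nsmul_eq_mul, mul_one]

section Cube

variable [DecidableEq σ]

/-- The sign vector `ε ∈ {±1}^n` attached to `ε : σ → Bool`: the evaluation points of the cube
identity `two_pow_mul_evenSignForm` by which this file computes the paper's inner products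
`⟨coeff f, v_f⟩` (the source evaluates a related form at the all ones vector instead).
[cite: AhmadiMajumdar2019, §3.2 proof of Proposition 1 (evaluation device of this formalisation)] -/
def signVec (ε : σ → Bool) : σ → ℝ := fun i => if ε i then -1 else 1

omit [Fintype σ] [DecidableEq σ] in
/-- `ε_i² = 1`. -/
@[folklore] private theorem signVec_sq (ε : σ → Bool) (i : σ) : signVec ε i ^ 2 = 1 := by
  unfold signVec; split_ifs <;> norm_num

/-- Orthogonality of characters of `{±1}^n`: `Σ_ε ε^γ = 2^n` if `x^γ` is even and `0` otherwise. -/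
@[folklore] private theorem sum_prod_signVec_pow (γ : σ →₀ ℕ) :
    ∑ ε : σ → Bool, ∏ i, signVec ε i ^ γ i = if ∀ i, Even (γ i) then 2 ^ Fintype.card σ else 0 := by
  have h1 : ∏ i, ((-1 : ℝ) ^ γ i + 1) = ∏ i, ∑ b : Bool, (if b then (-1 : ℝ) else 1) ^ γ i :=
    Finset.prod_congr rfl fun i _ => by rw [Fintype.sum_bool]; simp
  have h2 : ∑ ε : σ → Bool, ∏ i, signVec ε i ^ γ i = ∏ i, ((-1 : ℝ) ^ γ i + 1) := by
    rw [h1, Fintype.prod_sum]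
    rfl
  rw [h2]
  split_ifs with hev
  · rw [Finset.prod_eq_pow_card fun i _ => show (-1 : ℝ) ^ γ i + 1 = 2 by
      rw [(hev i).neg_one_pow]; norm_num, Finset.card_univ]
  · obtain ⟨i, hi⟩ := not_forall.1 hev
    exact Finset.prod_eq_zero (Finset.mem_univ i)
      (by rw [(Nat.not_even_iff_odd.1 hi).neg_one_pow]; norm_num)

/-- **The functional as a signed cube average**: `2^n ⟨coeff f, v_f⟩ = 2 Σ_{ε∈{±1}^n} f(ε) −
2^n f(1,…,1)` (the average of `f` over the cube retains exactly the even monomials; `f(1)` is the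
sum of all coefficients). [cite: AhmadiMajumdar2019, §3.2 proof of Proposition 1 ("this inner product is equal to the value that a related sdsos form q takes at the all ones vector")] -/
theorem two_pow_mul_evenSignForm (f : MvPolynomial σ ℝ) :
    2 ^ Fintype.card σ * evenSignForm f =
      2 * ∑ ε : σ → Bool, eval (signVec ε) f - 2 ^ Fintype.card σ * eval (fun _ => (1 : ℝ)) f := by
  have key : ∀ (γ : σ →₀ ℕ) (c : ℝ), 2 ^ Fintype.card σ * evenSignForm (monomial γ c) =
      2 * ∑ ε : σ → Bool, eval (signVec ε) (monomial γ c) -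
        2 ^ Fintype.card σ * eval (fun _ => (1 : ℝ)) (monomial γ c) := by
    intro γ c
    have hone : eval (fun _ => (1 : ℝ)) (monomial γ c) = c := by
      simp [eval_monomial, Finsupp.prod]
    simp only [evenSignForm_monomial, eval_monomial, Finsupp.prod_pow, ← Finset.mul_sum,
      sum_prod_signVec_pow, hone]
    unfold evenSign
    split_ifs <;> ring
  conv_lhs => rw [f.as_sum, map_sum, Finset.mul_sum]
  conv_rhs => rw [f.as_sum]; simp only [map_sum]; rw [Finset.sum_comm, Finset.mul_sum, Finset.mul_sum,
    ← Finset.sum_sub_distrib]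
  exact Finset.sum_congr rfl fun γ _ => key γ _

/-- **Proposition 1, cube form of the separation**: for sdsos `f`, `2^n f(1,…,1) ≤ 2 Σ_{ε∈{±1}^n} f(ε)`.
[cite: AhmadiMajumdar2019, §3.2 proof of Proposition 1] -/
theorem IsSdsos.two_pow_mul_eval_one_le {f : MvPolynomial σ ℝ} (h : IsSdsos f) :
    2 ^ Fintype.card σ * eval (fun _ => (1 : ℝ)) f ≤ 2 * ∑ ε : σ → Bool, eval (signVec ε) f := by
  have h1 := two_pow_mul_evenSignForm f
  have h2 : 0 ≤ 2 ^ Fintype.card σ * evenSignForm f :=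
    mul_nonneg (pow_nonneg zero_le_two _) h.evenSignForm_nonneg
  linarith

/-- Pair correlations on the cube: `Σ_ε ε_i ε_j = 2^n [i = j]`. -/
@[folklore] private theorem sum_signVec_mul_signVec (i j : σ) :
    ∑ ε : σ → Bool, signVec ε i * signVec ε j = if i = j then 2 ^ Fintype.card σ else 0 := by
  split_ifs with hij
  · subst hij
    simp only [← sq, signVec_sq, Finset.sum_const, Finset.card_univ, Fintype.card_fun,
      Fintype.card_bool, nsmul_eq_mul, mul_one, Nat.cast_pow, Nat.cast_ofNat]
  · -- flipping the `i`-th sign is an involution of the cube negating the summand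
    have hinv : Function.Involutive fun ε : σ → Bool => Function.update ε i (!ε i) := fun ε => by
      ext k
      by_cases hk : k = i
      · subst hk; simp
      · simp [hk]
    have hsum := Equiv.sum_comp hinv.toPerm fun ε => signVec ε i * signVec ε j
    have hflip : ∀ ε : σ → Bool, signVec (Function.update ε i (!ε i)) i *
        signVec (Function.update ε i (!ε i)) j = -(signVec ε i * signVec ε j) := fun ε => by
      simp only [signVec, Function.update_self, Function.update_of_ne (Ne.symm hij)]
      cases ε i <;> cases ε j <;> norm_num
    have hsum' : ∑ ε : σ → Bool, -(signVec ε i * signVec ε j) =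
        ∑ ε : σ → Bool, signVec ε i * signVec ε j := by
      rw [← hsum]
      exact Finset.sum_congr rfl fun ε _ => (hflip ε).symm
    rw [Finset.sum_neg_distrib] at hsum'
    linarith

/-- `Σ_ε (Σ_i ε_i)² = n 2^n`. -/
@[folklore] private theorem sum_sq_sum_signVec :
    ∑ ε : σ → Bool, (∑ i, signVec ε i) ^ 2 = Fintype.card σ * 2 ^ Fintype.card σ := by
  simp only [sq, Finset.sum_mul_sum]
  rw [Finset.sum_comm]
  calc ∑ i, ∑ ε : σ → Bool, ∑ j, signVec ε i * signVec ε j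
      = ∑ _i : σ, (2 : ℝ) ^ Fintype.card σ := Finset.sum_congr rfl fun i _ => by
        rw [Finset.sum_comm]
        simp only [sum_signVec_mul_signVec, Finset.sum_ite_eq, Finset.mem_univ, if_true]
    _ = Fintype.card σ * 2 ^ Fintype.card σ := by
        rw [Finset.sum_const, Finset.card_univ, nsmul_eq_mul]

/-- Values of `f_r = p_a · (Σ x_i²)^r` on the cube: `Σ_ε f_r(ε) = 2^n (n + a n) n^r`.
[cite: AhmadiMajumdar2019, §3.2 proof of Proposition 1 (latter claim, `p·(Σ x_i²)^r`)] -/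
theorem sum_eval_signVec_amForm_mul (a : ℝ) (r : ℕ) :
    ∑ ε : σ → Bool, eval (signVec ε) (amForm a * (∑ i, X i ^ 2) ^ r) =
      2 ^ Fintype.card σ * ((Fintype.card σ + a * Fintype.card σ) * (Fintype.card σ : ℝ) ^ r) := by
  have hpt : ∀ ε : σ → Bool, eval (signVec ε) (amForm a * (∑ i, X i ^ 2) ^ r) =
      ((∑ i, signVec ε i) ^ 2 + a * Fintype.card σ) * (Fintype.card σ : ℝ) ^ r := fun ε => by
    simp only [amForm, map_mul, map_add, map_pow, map_sum, eval_C, eval_X, signVec_sq,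
      Finset.sum_const, Finset.card_univ, nsmul_eq_mul, mul_one]
  rw [Finset.sum_congr rfl fun ε _ => hpt ε, ← Finset.sum_mul, Finset.sum_add_distrib,
    sum_sq_sum_signVec, Finset.sum_const, Finset.card_univ, Fintype.card_fun, Fintype.card_bool,
    nsmul_eq_mul]
  push_cast
  ring

end Cube

/-- **Proposition 1 in `n` variables.** For `a < n − 2` the form `p_a = (Σ x_i)² + a Σ x_i²` is not
r-sdsos for any `r`: "the inner product of the coefficients of `f_r = p·(Σ x_i²)^r` with `v_{f_r}` is
negative" — indeed it equals `n^{r+1} (a + 2 − n) < 0`.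
[cite: AhmadiMajumdar2019, §3.2 Proposition 1 and its proof (latter claim)] -/
theorem not_isRSdsos_amForm [Nonempty σ] {a : ℝ} (ha : a < Fintype.card σ - 2) (r : ℕ) :
    ¬ IsRSdsos r (amForm a : MvPolynomial σ ℝ) := by
  classical
  intro h
  have key := IsSdsos.two_pow_mul_eval_one_le h
  rw [sum_eval_signVec_amForm_mul, eval_one_amForm_mul] at key
  have hn : (0 : ℝ) < Fintype.card σ := Nat.cast_pos.2 Fintype.card_pos
  have hP : (0 : ℝ) < 2 ^ Fintype.card σ * (Fintype.card σ : ℝ) ^ r * Fintype.card σ := by positivity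
  have hid : 2 ^ Fintype.card σ * (((Fintype.card σ : ℝ) ^ 2 + a * Fintype.card σ) *
      (Fintype.card σ : ℝ) ^ r) - 2 * (2 ^ Fintype.card σ * ((Fintype.card σ + a * Fintype.card σ) *
      (Fintype.card σ : ℝ) ^ r)) =
      2 ^ Fintype.card σ * (Fintype.card σ : ℝ) ^ r * Fintype.card σ * (Fintype.card σ - 2 - a) := by
    ring
  have hpos : 0 < 2 ^ Fintype.card σ * (Fintype.card σ : ℝ) ^ r * Fintype.card σ *
      (Fintype.card σ - 2 - a) := mul_pos hP (by linarith)
  linarith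

/-- Nor is it r-dsos. [cite: AhmadiMajumdar2019, §3.2 Proposition 1] -/
theorem not_isRDsos_amForm [Nonempty σ] {a : ℝ} (ha : a < Fintype.card σ - 2) (r : ℕ) :
    ¬ IsRDsos r (amForm a : MvPolynomial σ ℝ) :=
  fun h => not_isRSdsos_amForm ha r h.isRSdsos

end Separation

/-- **The quadratic form of Proposition 1**: `p(x₁,x₂,x₃) = (x₁+x₂+x₃)² + a(x₁²+x₂²+x₃²)`.
[cite: AhmadiMajumdar2019, §3.2 Proposition 1, display (eq:not.rsdsos.poly)] -/
def amCounterexample (a : ℝ) : MvPolynomial (Fin 3) ℝ :=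
  (X 0 + X 1 + X 2) ^ 2 + C a * (X 0 ^ 2 + X 1 ^ 2 + X 2 ^ 2)

/-- The printed form is `amForm a` in the variables `x₁, x₂, x₃ = X 0, X 1, X 2`.
[cite: AhmadiMajumdar2019, §3.2 Proposition 1 (n = 3)] -/
theorem amCounterexample_eq_amForm (a : ℝ) : amCounterexample a = amForm a := by
  simp [amCounterexample, amForm, Fin.sum_univ_three]

/-- **Proposition 1 (Ahmadi–Majumdar), first half**: for `a > 0` the form is positive definite.
[cite: AhmadiMajumdar2019, §3.2 Proposition 1] -/
theorem amCounterexample_posDef {a : ℝ} (ha : 0 < a) (x : Fin 3 → ℝ) (hx : x ≠ 0) :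
    0 < eval x (amCounterexample a) := by
  rw [amCounterexample_eq_amForm]
  exact amForm_posDef ha x hx

/-- **Proposition 1 (Ahmadi–Majumdar), second half**: for `a < 1` the form
`(x₁+x₂+x₃)² + a(x₁²+x₂²+x₃²)` is not r-sdsos for any `r` (so for `0 < a < 1` it is a positive definite
form outside every level of the r-sdsos hierarchy: evenness cannot be dropped from Theorem 7).
[cite: AhmadiMajumdar2019, §3.2 Proposition 1 (pd but not r-sdsos for any r)] -/
theorem not_isRSdsos_amCounterexample {a : ℝ} (ha : a < 1) (r : ℕ) :
    ¬ IsRSdsos r (amCounterexample a) := by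
  rw [amCounterexample_eq_amForm]
  exact not_isRSdsos_amForm (by simp; linarith) r

/-- … and hence not r-dsos for any `r`. [cite: AhmadiMajumdar2019, §3.2 Proposition 1] -/
theorem not_isRDsos_amCounterexample {a : ℝ} (ha : a < 1) (r : ℕ) :
    ¬ IsRDsos r (amCounterexample a) :=
  fun h => not_isRSdsos_amCounterexample ha r h.isRSdsos

/-! ### Examples 1 and 2: the printed LP certificates, kernel-checked

`1DSOS_{3,6} ⊄ SOS_{3,6}` and `2DSOS_{3,6} ⊄ SOS_{3,6}`: the decompositions "found by solving an LP"
in the paper are verified here as polynomial identities (`ring`) and turned into `IsRDsos`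
certificates with the cone operations above. Variables `x₁, x₂, x₃` are `X 0, X 1, X 2`. -/

section Examples

/-- The square of a difference of two monomials is dsos (one term of the third sum of (eq:dsos), with
weight `1`). [cite: AhmadiMajumdar2019, §3.1 Definition 1 (dsos)] -/
theorem isDsos_sq_monomial_sub (γ δ : σ →₀ ℕ) :
    IsDsos ((monomial γ (1 : ℝ) - monomial δ 1) ^ 2) :=
  IsDsos.of_terms (ι := Unit) (fun _ => γ) (fun _ => δ) (fun _ => 1) (fun _ => -1)
    (fun _ => zero_le_one) (fun _ => Or.inr (Or.inr rfl)) (by simp [sub_eq_add_neg])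

/-- The monomial `x₁^a x₂^b x₃^c` in three variables (plumbing for the examples). [folklore] -/
@[folklore] private theorem monomial_fin3 (a b c : ℕ) :
    monomial (Finsupp.single 0 a + (Finsupp.single 1 b + Finsupp.single 2 c)) (1 : ℝ) =
      (X 0 ^ a * X 1 ^ b * X 2 ^ c : MvPolynomial (Fin 3) ℝ) := by
  rw [monomial_single_add, monomial_single_add, ← X_pow_eq_monomial, mul_assoc]

/-- Shorthand for the monomial `x₁^a x₂^b x₃^c` as `monomial _ 1` (plumbing). [folklore] -/
@[folklore] private def m3 (a b c : ℕ) : MvPolynomial (Fin 3) ℝ :=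
  monomial (Finsupp.single 0 a + (Finsupp.single 1 b + Finsupp.single 2 c)) 1

/-- `m3 a b c = x₁^a x₂^b x₃^c`. [folklore] -/
@[folklore] private theorem m3_eq (a b c : ℕ) : m3 a b c = X 0 ^ a * X 1 ^ b * X 2 ^ c := monomial_fin3 a b c

/-- A weighted square `w · (m − m')²`, `w ≥ 0`, of a difference of two monomials is dsos (plumbing for
the examples). [folklore] -/
@[folklore] private theorem isDsos_smul_sq_m3_sub {w : ℝ} (hw : 0 ≤ w) (a b c a' b' c' : ℕ) :
    IsDsos (C w * (m3 a b c - m3 a' b' c') ^ 2) :=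
  (isDsos_sq_monomial_sub _ _).smul hw

/-- Halving a doubled certificate: `Y = C(1/2) · (2 Y)`. [folklore] -/
@[folklore] private theorem eq_C_half_mul_two_mul (Y : MvPolynomial (Fin 3) ℝ) : Y = C (1 / 2 : ℝ) * (2 * Y) := by
  rw [← mul_assoc, ← map_ofNat C 2, ← map_mul]
  norm_num

/-- `Σ_{i : Fin 3} x_i² = x₁² + x₂² + x₃²`. [folklore] -/
@[folklore] private theorem sum_X_sq_fin3 : (∑ i : Fin 3, X i ^ 2 : MvPolynomial (Fin 3) ℝ) =
    X 0 ^ 2 + X 1 ^ 2 + X 2 ^ 2 := by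
  simp [Fin.sum_univ_three]

/-- **Example 2's polynomial** `p(x) = x₁⁴x₂² + x₂⁴x₃² + x₃⁴x₁² − 3x₁²x₂²x₃²` (nonnegative, not a sum
of squares [Reznick]). [cite: AhmadiMajumdar2019, §3.2 Example 2] -/
def example2 : MvPolynomial (Fin 3) ℝ :=
  X 0 ^ 4 * X 1 ^ 2 + X 1 ^ 4 * X 2 ^ 2 + X 2 ^ 4 * X 0 ^ 2 - 3 * (X 0 ^ 2 * X 1 ^ 2 * X 2 ^ 2)

/-- **Example 2, the printed decomposition** (doubled to clear the halves):
`2·p·(Σ x_i²) = 2(x₃x₂²x₁ − x₃³x₁)² + (x₃²x₁² − x₃²x₂²)² + 2(x₃x₂³ − x₃x₂x₁²)² + (x₂²x₁² − x₃²x₂²)²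
 + (x₂²x₁² − x₃²x₁²)² + 2(x₂x₁³ − x₃²x₂x₁)²`. [cite: AhmadiMajumdar2019, §3.2 Example 2 (display)] -/
theorem two_mul_example2_mul_eq :
    2 * (example2 * (X 0 ^ 2 + X 1 ^ 2 + X 2 ^ 2)) =
      C 2 * (m3 1 2 1 - m3 1 0 3) ^ 2 + C 1 * (m3 2 0 2 - m3 0 2 2) ^ 2 +
      C 2 * (m3 0 3 1 - m3 2 1 1) ^ 2 + C 1 * (m3 2 2 0 - m3 0 2 2) ^ 2 +
      C 1 * (m3 2 2 0 - m3 2 0 2) ^ 2 + C 2 * (m3 3 1 0 - m3 1 1 2) ^ 2 := by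
  simp only [example2, m3_eq, map_ofNat, C_1]
  ring

/-- **Example 2 (Ahmadi–Majumdar): `p ∈ 1DSOS_{3,6}`** — the LP certificate above, kernel-checked.
[cite: AhmadiMajumdar2019, §3.2 Example 2 (p is 1-dsos)] -/
theorem isRDsos_one_example2 : IsRDsos 1 example2 := by
  have hd : IsDsos (2 * (example2 * (X 0 ^ 2 + X 1 ^ 2 + X 2 ^ 2))) := by
    rw [two_mul_example2_mul_eq]
    refine IsDsos.add (IsDsos.add (IsDsos.add (IsDsos.add (IsDsos.add ?_ ?_) ?_) ?_) ?_) ?_ <;>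
      exact isDsos_smul_sq_m3_sub (by norm_num) _ _ _ _ _ _
  show IsDsos _
  rw [pow_one, sum_X_sq_fin3, eq_C_half_mul_two_mul (example2 * _)]
  exact hd.smul (by norm_num)

/-- Hence `p` of Example 2 is nonnegative ("and thus that `p` is nonnegative").
[cite: AhmadiMajumdar2019, §3.2 Example 2] -/
theorem example2_nonneg (x : Fin 3 → ℝ) : 0 ≤ eval x example2 :=
  isRDsos_one_example2.eval_nonneg x

/-- **Example 1: the Motzkin polynomial** `M(x) = x₁⁴x₂² + x₁²x₂⁴ − 3x₁²x₂²x₃² + x₃⁶`.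
[cite: AhmadiMajumdar2019, §3.2 Example 1; MotzkinSOS] -/
def motzkin : MvPolynomial (Fin 3) ℝ :=
  X 0 ^ 4 * X 1 ^ 2 + X 0 ^ 2 * X 1 ^ 4 - 3 * (X 0 ^ 2 * X 1 ^ 2 * X 2 ^ 2) + X 2 ^ 6

/-- **Example 1, the printed decomposition** (doubled to clear the halves): `2·M·(Σ x_i²)²` equals the
eleven weighted binomial squares of the paper with weights `1,1,1,1,1,5,1,5,1,1,1`.
[cite: AhmadiMajumdar2019, §3.2 Example 1 (display)] -/
theorem two_mul_motzkin_mul_eq :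
    2 * (motzkin * (X 0 ^ 2 + X 1 ^ 2 + X 2 ^ 2) ^ 2) =
      C 1 * (m3 0 0 5 - m3 0 2 3) ^ 2 + C 1 * (m3 1 4 0 - m3 1 0 4) ^ 2 +
      C 1 * (m3 1 4 0 - m3 1 2 2) ^ 2 + C 1 * (m3 0 0 5 - m3 2 0 3) ^ 2 +
      C 1 * (m3 2 0 3 - m3 0 2 3) ^ 2 + C 5 * (m3 2 3 0 - m3 0 1 4) ^ 2 +
      C 1 * (m3 2 3 0 - m3 2 1 2) ^ 2 + C 5 * (m3 3 2 0 - m3 1 0 4) ^ 2 +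
      C 1 * (m3 3 2 0 - m3 1 2 2) ^ 2 + C 1 * (m3 4 1 0 - m3 0 1 4) ^ 2 +
      C 1 * (m3 4 1 0 - m3 2 1 2) ^ 2 := by
  simp only [motzkin, m3_eq, map_ofNat, C_1]
  ring

/-- **Example 1 (Ahmadi–Majumdar): the Motzkin polynomial is 2-dsos** (`M ∈ 2DSOS_{3,6}`, so r-dsos
certificates reach beyond sums of squares) — the LP certificate above, kernel-checked.
[cite: AhmadiMajumdar2019, §3.2 Example 1 (M is 2-dsos)] -/
theorem isRDsos_two_motzkin : IsRDsos 2 motzkin := by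
  have hd : IsDsos (2 * (motzkin * (X 0 ^ 2 + X 1 ^ 2 + X 2 ^ 2) ^ 2)) := by
    rw [two_mul_motzkin_mul_eq]
    refine IsDsos.add (IsDsos.add (IsDsos.add (IsDsos.add (IsDsos.add (IsDsos.add (IsDsos.add
      (IsDsos.add (IsDsos.add (IsDsos.add ?_ ?_) ?_) ?_) ?_) ?_) ?_) ?_) ?_) ?_) ?_ <;>
      exact isDsos_smul_sq_m3_sub (by norm_num) _ _ _ _ _ _
  show IsDsos _
  rw [sum_X_sq_fin3, eq_C_half_mul_two_mul (motzkin * _)]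
  exact hd.smul (by norm_num)

/-- Hence the Motzkin polynomial is nonnegative. [cite: AhmadiMajumdar2019, §3.2 Example 1] -/
theorem motzkin_nonneg (x : Fin 3 → ℝ) : 0 ≤ eval x motzkin :=
  isRDsos_two_motzkin.eval_nonneg x

end Examples

end Literature.Algebra.Polynomial.DsosSdsos

end
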